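import Mathlib
import HarnessLib

/-!
# Randomized truncation: the single-term and the sum ("coupled-sum") unbiased estimators of
# Rhee–Glynn / McLeish, their second moments and their expected cost

HONEST FRAMING: exact (Metropolis-corrected) sampling algorithms for lattice gauge theory;
figures of merit are autocorrelation/cost numbers at stated couplings and volumes; no
continuum-physics claim.

Topic `Probability/Moments` (sibling of `BhanotKennedyEstimator.lean`, which is ONE randomized
series estimator; this file is the general device).  PUBLISHED RESULTS with our formalisation
(Mathlib probability: independence, Bochner integral, summable series); every statement proved,
no named fact.

Sources (all READ at the locators).
* C.-H. Rhee, P. W. Glynn, *A new approach to unbiased estimation for SDE's*, Proc. Winter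
  Simulation Conference 2012 [arXiv:1207.2452] [RheeGlynn2012], §2 "The basic idea": for a random
  level `N` independent of the approximations, "`E k(X) = E[k(X_1) + Σ_{n=1}^N (k(X_{2^{-n}}) −
  k(X_{2^{-(n-1)}}))/P(N ≥ n)] ≜ E Z` … Note that `Z` is an unbiased estimator"; the second-moment
  expansion "`E Z² = E k²(X_1) + Σ_i E Δ_i²/P(N ≥ i) + 2E k(X_1)Σ_i Δ_i + 2 Σ_i Σ_{j>i}
  E Δ_iΔ_j/P(N ≥ i)`"; and eq. (3): "The expected computational work required for each `Z` is …
  `E Σ_{i=0}^N t_i` … and hence can be expressed as `Σ_{i=0}^∞ t_i P(N ≥ i)`".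
* C.-H. Rhee, P. W. Glynn, *Unbiased estimation with square root convergence for SDE models*,
  Oper. Res. 63 (2015) 1026–1043 [RheeGlynn2015], Theorem 1 (the "coupled-sum" estimator
  `Σ_{n=0}^N (S_n − S_{n−1})/P(N ≥ n)`: `E Y = E S`, `E Y² = Σ_n (E|S − S_{n−1}|² − E|S − S_n|²)/
  P(N ≥ n)`), as quoted verbatim in [JacobThiery2015, §1.2 Theorem 1.1]; Theorems 1 and 2 (coupled
  and independent sum) as restated in C. Zheng, J. Pan, Q. Wang [arXiv:2304.07797]
  [ZhengPanWang2023, §2 Theorems 2.1–2.2] ("If `Σ_{n≥1} E[(Y_n − Y)²]/P(N ≥ n) < ∞` then `Z ∈ L²` is an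
  unbiased estimator of `E(Y)`, and `E(Z²) = Σ_{n≥0} v_n/P(N ≥ n)` where `v_n = E[(Y_{n−1} − Y)²] −
  E[(Y_n − Y)²]`"; "`E(Z̃²) = Σ_{n≥0} ṽ_n/P(N ≥ n)` where `ṽ_n = var(Y_n − Y_{n−1}) + (E(Y) − E(Y_{n−1}))²
  − (E(Y) − E(Y_n))²`").
* D. McLeish, *A general method for debiasing a Monte Carlo estimator*, Monte Carlo Methods
  Appl. 17 (2011) [arXiv:1005.2228] [McLeish2011], §2: `Y = x₀ + Σ_{n=1}^N ∇X_n/Q_n =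
  x₀ + Σ_{n≥1} ∇X_n I(n ≤ N)/Q_n`, `Q_n = P(N ≥ n) > 0`, "It is obviously unbiased provided that
  it is integrable and one can interchange the sum and the expected value"; and the cost constraint
  "subject to `Σ_n Q_n = μ`" (= `E N`).
* M. Vihola, *Unbiased estimators and multilevel Monte Carlo*, Oper. Res. 66 (2018) 448–462
  [arXiv:1512.01022] [Vihola2018], §3: Condition 2 (`Σ_i E Δ_i²/p_i < ∞`), **Theorem 3 (single
  term estimator)** "`Z⁽¹⁾ := Δ_R/p_R` satisfies `E Z⁽¹⁾ = E Y` and `E (Z⁽¹⁾)² = Σ_i E Δ_i²/p_i`",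
  **Theorem 5 (sum estimator)** "`Z_Σ⁽¹⁾ := Σ_{i=1}^R Δ_i/p̃_i`, `p̃_i := Σ_{j ≥ i} p_j` … satisfies
  `E Z_Σ⁽¹⁾ = E Y`", Example 9 (`var(Z⁽¹⁾) = Σ_i E Δ_i²/p_i − (E Y)²`) and Example 10 (the finite-`m`
  identity "because `Δ_i² + 2Δ_i(Y_m − Y_i) = (Y_{i−1} − Y_m)² − (Y_i − Y_m)²`").

Lean reading.  On a measure space `(Ω, μ)`: the INCREMENTS are real random variables
`Δ : ℕ → Ω → ℝ` (our `Δ k` is the printed `Δ_{k+1} = Y_{k+1} − Y_k`; `partialSum Δ n = Σ_{k<n} Δ k`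
is the printed biased approximation `Y_n`, `Y_0 = 0`), the RANDOM LEVEL is `R : Ω → ℕ` (the
printed `R`, resp. `N`, minus one), `p k = μ{R = k}` and `q k = μ{k ≤ R}` (the printed `p_i`,
`p̃_i = P(N ≥ i) = Q_i`).  Independence of the level from the increments is assumed TERMWISE
(`IndepFun R (Δ k) μ` for every `k`, resp. `IndepFun R (Δ i · Δ k) μ` for the second moment of the
sum estimator) — weaker than the printed "`R` independent of `(Δ_i)_{i≥1}`", which implies it
(`indepFun_mul_of_indepFun_pi`).

Contents (all proved).
* `singleTerm Δ p R = Δ_R/p_R`, `sumEst Δ q R = Σ_{k ≤ R} Δ_k/q_k`, `sumEstTrunc Δ q R m =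
  Σ_{k<m, k ≤ R} Δ_k/q_k` (the sum estimator of the `m`-level scheme `Y_m`), `partialSum`.
* `integral_indicator_eq_mul` / `integral_indicator_le_mul` — `E[1_{R=k} X] = μ{R=k}·E X`,
  `E[1_{k≤R} X] = μ{k≤R}·E X` for `X` independent of `R` (the one use of independence).
* **`hasSum_integral_singleTerm`** — [Vihola2018, Thm 3, first claim] / [RheeGlynn2015]: if
  `Σ_k E|Δ_k| < ∞` then `Z⁽¹⁾` is integrable and `E Z⁽¹⁾ = Σ_k E Δ_k` (`= lim E Y_n`); and
  `summable_integral_abs_of_cond2` — the printed Condition 2 `Σ_k E Δ_k²/p_k < ∞` (with `Σ p_k < ∞`)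
  implies `Σ_k E|Δ_k| < ∞`, so **`hasSum_integral_singleTerm_of_cond2`** is Theorem 3 as printed.
* **`hasSum_integral_singleTerm_sq`** — [Vihola2018, Thm 3, second claim]: under Condition 2,
  `E (Z⁽¹⁾)² = Σ_k E Δ_k²/p_k`; **`variance_singleTerm`** — [Vihola2018, Example 9]:
  `var(Z⁽¹⁾) = Σ_k E Δ_k²/p_k − (Σ_k E Δ_k)²`.
* **`hasSum_integral_sumEst`** — [McLeish2011, §2] / [Vihola2018, Thm 5, first claim] /
  [RheeGlynn2012, §2]: if `Σ_k E|Δ_k| < ∞` then `Z_Σ` is integrable and `E Z_Σ = Σ_k E Δ_k`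
  (McLeish's "interchange the sum and the expected value", here by absolute convergence in `L¹`).
* **`integral_sumEstTrunc_sq`** — [RheeGlynn2012, §2 (display for `E Z²`)] at `m` levels:
  `E Z_m² = Σ_{i<m} E Δ_i²/q_i + 2 Σ_{i<m} Σ_{i<j<m} E Δ_iΔ_j/q_i`, and its telescoped form
  **`integral_sumEstTrunc_sq_telescope`** — [Vihola2018, Example 10] / [RheeGlynn2015, Thm 1]:
  `E Z_m² = Σ_{i<m} (E(Y_i − Y_m)² − E(Y_{i+1} − Y_m)²)/q_i`.
* COST: **`lintegral_cost_sumEst`** — [RheeGlynn2012, §2 eq. (3)]: with level costs `t_k`,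
  `E Σ_{k ≤ R} t_k = Σ_k t_k μ{k ≤ R}`; `lintegral_cost_singleTerm` (`E t_R = Σ_k t_k μ{R = k}`);
  **`lintegral_level_eq_tsum`** — [McLeish2011, §2 ("subject to `Σ_n Q_n = μ`")]:
  `E R = Σ_{k≥1} μ{k ≤ R}`.

* INFINITELY MANY LEVELS (the coupled sum under Rhee–Glynn's `L²` condition, in our indexing
  `Σ_i E(Y_i − S)²/q_i < ∞` for a square-integrable `S`; printed `Σ_{i≥1} E(Y_{i−1} − Y)²/p̃_i < ∞`):
  `integral_sub_sumEstTrunc_sq` / `integral_sub_sumEstTrunc_sq_telescope` (two-index finite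
  identities, Vihola's `v_{ℓ,m}`), **`integral_sub_sumEstTrunc_sq_le`** — [Vihola2018, Example 10]:
  `E(Z_n − Z_m)² ≤ 4 Σ_{m≤i≤n} E(Y_i − S)²/q_i` (summation by parts), the generic steps
  `memLp_sub_sumEstTrunc_of_bound` (Fatou: a uniform Cauchy bound `E(Z_n − Z_m)² ≤ B` gives
  `Z_Σ − Z_m ∈ L²`, `E(Z_Σ − Z_m)² ≤ B`, the truncations being eventually constant pointwise),
  `tendsto_integral_sq_of_tendsto`, `integral_eq_of_tendsto`, then **`memLp_sub_sumEstTrunc`** /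
  **`memLp_sumEst`** / `tendsto_integral_sub_sumEstTrunc_sq` — [Vihola2018, App. A proof of Thm 7]:
  `Z_Σ ∈ L²`, `Z_m → Z_Σ` in `L²`,
  **`integral_sumEst_eq`** — [RheeGlynn2015, Thm 1] / [Vihola2018, Thm 5]: `E Z_Σ = E S`,
  `tendsto_integral_sumEstTrunc_sq` (`E Z_m² → E Z_Σ²`), the Abel weights `abelWeight` with
  `integral_sumEstTrunc_sq_abel` (`E Z_m² = Σ_{i<m} E(Y_i − Y_m)² w_i`), the real-sequence lemmas
  `sum_Ico_sub_div_le` (the summation-by-parts estimate), `tendsto_sum_mul_abelWeight_of_abs_sub_le`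
  (Vihola's "by dominated convergence", here two Cauchy–Schwarz estimates) and
  `hasSum_sub_div_abelWeight` (the printed series = the Abel-summed one), and the printed second
  moment **`hasSum_integral_sumEst_sq`** — [RheeGlynn2015, Thm 1] / [Vihola2018, Thm 5 (coupled
  sum)]: `E Z_Σ² = Σ_i (E(Y_i − S)² − E(Y_{i+1} − S)²)/q_i` (absolutely convergent), with
  **`variance_sumEst`** — [Vihola2018, Example 10 at `n = 1`].
* THE INDEPENDENT-SUM CASE (Vihola's Condition 4 (ii): UNCORRELATED increments, `E Δ_iΔ_k =
  E Δ_i E Δ_k` for `i ≠ k`, and a real `L` = the printed `E Y` with `Σ_i (var Δ_i + (L − M_i)²)/q_i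
  < ∞`, `M_i = meanLevel μ Δ i = E Y_i`): `integral_sub_sumEstTrunc_sq_uncorr` (Vihola's `v_{ℓ,m}`),
  `integral_sub_sumEstTrunc_sq_le_uncorr` (`E(Z_n − Z_m)² ≤ 4 Σ_{m≤i≤n} (var Δ_i + (L − M_i)²)/q_i`),
  **`memLp_sub_sumEstTrunc_uncorr`**, `tendsto_integral_sub_sumEstTrunc_sq_uncorr`,
  **`integral_sumEst_eq_uncorr`** (`E Z_Σ = L`) and **`hasSum_integral_sumEst_sq_uncorr`** —
  [Vihola2018, Thm 5 (independent sum)] / Rhee–Glynn's Theorem 2: `E Z_Σ² = Σ_i (var Δ_i +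
  (L − M_i)² − (L − M_{i+1})²)/q_i`.

Deliberate omissions: Vihola's general scheme (Theorem 7 with general `N_i`), stratified / residual
sampling and the MLMC comparison are not formalised; independence of `R` is used only through
`IndepFun R (Δ_iΔ_k)` (and `IndepFun R Δ_k` for the mean).

Context (cell pub-lqcd, HOME/R2-SCOPE.md §3 N2 / D3, §4 cost classes): unbiased estimators of
`tr log`, `det`-ratios or `exp`-weights built from a convergent sequence of biased approximations
(polynomial / rational / multilevel truncations) are obtained by randomizing the truncation level;
the price is the variance `Σ E Δ_k²/p_k` against the expected cost `Σ t_k q_k` — the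
work-variance product that any "noisy exact" fermion scheme must report.
-/

noncomputable section

namespace Literature.Probability.Moments

open _root_.MeasureTheory _root_.ProbabilityTheory Finset
open scoped ENNReal

namespace RandomizedTruncation

variable {Ω : Type*}

/-! ## The estimators -/

/-- The SINGLE-TERM estimator `Z⁽¹⁾ = Δ_R / p_R`. [cite: Vihola2018, §3 Theorem 3];
[cite: RheeGlynn2015, §1 (single-term estimator)] -/
def singleTerm (Δ : ℕ → Ω → ℝ) (p : ℕ → ℝ) (R : Ω → ℕ) (ω : Ω) : ℝ :=
  Δ (R ω) ω / p (R ω)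

/-- The `k`-th summand of `Z⁽¹⁾` written as a series: `1_{R = k} Δ_k / p_k`.
[cite: Vihola2018, §4 Example 9 (`N_i = 1{R = i}`)] -/
def singleTermAt (Δ : ℕ → Ω → ℝ) (p : ℕ → ℝ) (R : Ω → ℕ) (k : ℕ) (ω : Ω) : ℝ :=
  if R ω = k then Δ k ω / p k else 0

/-- The SUM estimator `Z_Σ = Σ_{k ≤ R} Δ_k / q_k`, `q_k = μ{k ≤ R}` (Rhee–Glynn's coupled / independent
sum, McLeish's `Y`). [cite: Vihola2018, §3 Theorem 5]; [cite: McLeish2011, §2 (definition of `Y`)];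
[cite: RheeGlynn2012, §2 (definition of `Z`)] -/
def sumEst (Δ : ℕ → Ω → ℝ) (q : ℕ → ℝ) (R : Ω → ℕ) (ω : Ω) : ℝ :=
  ∑ k ∈ range (R ω + 1), Δ k ω / q k

/-- The `k`-th summand of `Z_Σ` written as a series: `1_{k ≤ R} Δ_k / q_k` (McLeish's
`∇X_n I(n ≤ N)/Q_n`). [cite: McLeish2011, §2 (second display)] -/
def sumTermAt (Δ : ℕ → Ω → ℝ) (q : ℕ → ℝ) (R : Ω → ℕ) (k : ℕ) (ω : Ω) : ℝ :=
  if k ≤ R ω then Δ k ω / q k else 0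

/-- The sum estimator of the `m`-LEVEL scheme: `Z_m = Σ_{k < m, k ≤ R} Δ_k / q_k` (the estimator
whose target is `E Y_m`). [cite: Vihola2018, §4 Example 10 (the quantities `v_{0,m}`)] -/
def sumEstTrunc (Δ : ℕ → Ω → ℝ) (q : ℕ → ℝ) (R : Ω → ℕ) (m : ℕ) (ω : Ω) : ℝ :=
  ∑ k ∈ range m, sumTermAt Δ q R k ω

/-- The biased approximations `Y_n = Σ_{k<n} Δ_k` (`Y_0 = 0`). [cite: Vihola2018, §3 (first
display: `E Y = lim_n Σ_{i=1}^n E(Y_i − Y_{i−1})`, `Y_0 ≡ 0`)] -/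
def partialSum (Δ : ℕ → Ω → ℝ) (n : ℕ) (ω : Ω) : ℝ :=
  ∑ k ∈ range n, Δ k ω

section Pointwise

variable (Δ : ℕ → Ω → ℝ) (p q : ℕ → ℝ) (R : Ω → ℕ)

/-- `Z⁽¹⁾ = Σ_k 1_{R=k} Δ_k/p_k` (one non-zero term). [cite: Vihola2018, §4 Example 9] -/
theorem singleTerm_eq_tsum (ω : Ω) : singleTerm Δ p R ω = ∑' k, singleTermAt Δ p R k ω := by
  rw [tsum_eq_single (R ω) (fun k hk => ?_)]
  · simp [singleTermAt, singleTerm]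
  · simp only [singleTermAt, ite_eq_right_iff]
    intro h
    exact absurd h.symm hk

/-- `Z_Σ = Σ_k 1_{k ≤ R} Δ_k/q_k` (finitely many non-zero terms). [cite: McLeish2011, §2 (second
display)] -/
theorem sumEst_eq_tsum (ω : Ω) : sumEst Δ q R ω = ∑' k, sumTermAt Δ q R k ω := by
  rw [tsum_eq_sum (s := range (R ω + 1)) (fun k hk => ?_)]
  · unfold sumEst
    refine sum_congr rfl (fun k hk => ?_)
    rw [mem_range] at hk
    simp [sumTermAt, Nat.lt_succ_iff.mp hk]
  · rw [mem_range, not_lt] at hk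
    simp only [sumTermAt, ite_eq_right_iff]
    intro h
    exfalso
    omega

/-- `Z_Σ = Z_m` as soon as `R < m`; in particular the `m`-level estimator IS the sum estimator of the
stopped sequence. [cite: Vihola2018, §4 Example 10] -/
theorem sumEstTrunc_eq_sumEst_of_lt {m : ℕ} {ω : Ω} (h : R ω < m) :
    sumEstTrunc Δ q R m ω = sumEst Δ q R ω := by
  unfold sumEstTrunc sumEst
  rw [← sum_range_add_sum_Ico _ (Nat.succ_le_of_lt h)]
  have h0 : ∑ k ∈ Ico (R ω + 1) m, sumTermAt Δ q R k ω = 0 := by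
    refine sum_eq_zero (fun k hk => ?_)
    rw [mem_Ico] at hk
    simp only [sumTermAt, ite_eq_right_iff]
    intro h'
    exfalso
    omega
  rw [h0, add_zero]
  refine sum_congr rfl (fun k hk => ?_)
  rw [mem_range] at hk
  simp [sumTermAt, Nat.lt_succ_iff.mp hk]

/-- If the scheme has only `m` levels (`Δ_k = 0` for `k ≥ m`) then `Z_Σ = Z_m` everywhere.
[cite: Vihola2018, §4 Example 10] -/
theorem sumEst_eq_sumEstTrunc_of_eq_zero {m : ℕ} (hΔ0 : ∀ k, m ≤ k → Δ k = 0) (ω : Ω) :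
    sumEst Δ q R ω = sumEstTrunc Δ q R m ω := by
  rw [sumEst_eq_tsum, sumEstTrunc, tsum_eq_sum (s := range m) (fun k hk => ?_)]
  rw [mem_range, not_lt] at hk
  simp [sumTermAt, hΔ0 k hk]

/-- `Z_m` is the sum estimator of the truncated increments `Δ·1_{k<m}`. [cite: Vihola2018, §4
Example 10] -/
theorem sumEstTrunc_eq_sumEst_truncate (m : ℕ) (ω : Ω) :
    sumEstTrunc Δ q R m ω = sumEst (fun k => if k < m then Δ k else 0) q R ω := by
  rw [sumEst_eq_sumEstTrunc_of_eq_zero (fun k => if k < m then Δ k else 0) q R (m := m)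
    (fun k hk => by simp [not_lt.mpr hk])]
  unfold sumEstTrunc
  refine sum_congr rfl (fun k hk => ?_)
  rw [mem_range] at hk
  simp [sumTermAt, hk]

/-- `(Z⁽¹⁾)² = Δ_R²/p_R²` is itself the single-term estimator of the increments `Δ_k²/p_k`.
[cite: Vihola2018, §3 Theorem 3 (second claim)] -/
theorem singleTerm_sq (ω : Ω) :
    singleTerm Δ p R ω ^ 2 = singleTerm (fun k ω => Δ k ω ^ 2 / p k) p R ω := by
  simp only [singleTerm]
  ring

/-- `singleTermAt k = 1_{R=k} · (Δ_k/p_k)` as an indicator. [cite: Vihola2018, §4 Example 9] -/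
theorem singleTermAt_eq_indicator (k : ℕ) :
    singleTermAt Δ p R k = {ω | R ω = k}.indicator (fun ω => Δ k ω / p k) := by
  ext ω
  simp only [singleTermAt, Set.indicator_apply, Set.mem_setOf_eq]

/-- `sumTermAt k = 1_{k≤R} · (Δ_k/q_k)` as an indicator. [cite: McLeish2011, §2] -/
theorem sumTermAt_eq_indicator (k : ℕ) :
    sumTermAt Δ q R k = {ω | k ≤ R ω}.indicator (fun ω => Δ k ω / q k) := by
  ext ω
  simp only [sumTermAt, Set.indicator_apply, Set.mem_setOf_eq]

/-- Product of two summands: for `i ≤ k`, `1_{i≤R}1_{k≤R} = 1_{k≤R}`, so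
`term_i · term_k = 1_{k≤R} Δ_iΔ_k/(q_i q_k)`. [cite: RheeGlynn2012, §2 (expansion of `E Z²`)] -/
theorem sumTermAt_mul_sumTermAt {i k : ℕ} (hik : i ≤ k) (ω : Ω) :
    sumTermAt Δ q R i ω * sumTermAt Δ q R k ω =
      (if k ≤ R ω then (1 : ℝ) else 0) * (Δ i ω * Δ k ω / (q i * q k)) := by
  by_cases hk : k ≤ R ω
  · have hi : i ≤ R ω := hik.trans hk
    simp only [sumTermAt, hi, hk, if_true, one_mul]
    ring
  · simp [sumTermAt, hk]

/-- `Y_{n+1} = Y_n + Δ_n`. [cite: Vihola2018, §3 (`Δ_i = Y_i − Y_{i−1}`)] -/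
theorem partialSum_succ (n : ℕ) (ω : Ω) :
    partialSum Δ (n + 1) ω = partialSum Δ n ω + Δ n ω := by
  simp [partialSum, sum_range_succ]

end Pointwise

/-! ## Measurability -/

section Measurability

variable [MeasurableSpace Ω] {Δ : ℕ → Ω → ℝ} {p q : ℕ → ℝ} {R : Ω → ℕ}

/-- `Z⁽¹⁾` is measurable. [cite: Vihola2018, §3 Theorem 3] -/
theorem measurable_singleTerm (hΔ : ∀ k, Measurable (Δ k)) (hR : Measurable R) :
    Measurable (singleTerm Δ p R) := by
  have hg : Measurable (fun z : Ω × ℕ => Δ z.2 z.1 / p z.2) :=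
    measurable_from_prod_countable_left (fun n => (hΔ n).div_const (p n))
  exact hg.comp (measurable_id.prodMk hR)

/-- `1_{R=k}Δ_k/p_k` is measurable. [cite: Vihola2018, §4 Example 9] -/
theorem measurable_singleTermAt (hΔ : ∀ k, Measurable (Δ k)) (hR : Measurable R) (k : ℕ) :
    Measurable (singleTermAt Δ p R k) := by
  rw [singleTermAt_eq_indicator]
  exact ((hΔ k).div_const _).indicator (hR (measurableSet_singleton k))

/-- `1_{k≤R}Δ_k/q_k` is measurable. [cite: McLeish2011, §2] -/
theorem measurable_sumTermAt (hΔ : ∀ k, Measurable (Δ k)) (hR : Measurable R) (k : ℕ) :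
    Measurable (sumTermAt Δ q R k) := by
  rw [sumTermAt_eq_indicator]
  exact ((hΔ k).div_const _).indicator (hR measurableSet_Ici)

/-- `Z_Σ` is measurable. [cite: Vihola2018, §3 Theorem 5] -/
theorem measurable_sumEst (hΔ : ∀ k, Measurable (Δ k)) (hR : Measurable R) :
    Measurable (sumEst Δ q R) := by
  have hg : Measurable (fun z : Ω × ℕ => ∑ k ∈ range (z.2 + 1), Δ k z.1 / q k) :=
    measurable_from_prod_countable_left
      (fun n => Finset.measurable_sum (range (n + 1)) (fun k _ => (hΔ k).div_const (q k)))
  exact hg.comp (measurable_id.prodMk hR)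

/-- `Z_m` is measurable. [cite: Vihola2018, §4 Example 10] -/
theorem measurable_sumEstTrunc (hΔ : ∀ k, Measurable (Δ k)) (hR : Measurable R) (m : ℕ) :
    Measurable (sumEstTrunc Δ q R m) := by
  unfold sumEstTrunc
  exact Finset.measurable_sum (range m) (fun k _ => measurable_sumTermAt hΔ hR k)

/-- `Y_n` is measurable. [cite: Vihola2018, §3] -/
theorem measurable_partialSum (hΔ : ∀ k, Measurable (Δ k)) (n : ℕ) :
    Measurable (partialSum Δ n) := by
  unfold partialSum
  exact Finset.measurable_sum (range n) (fun k _ => hΔ k)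

end Measurability

/-! ## The one use of independence: `E[1_{R ∈ A} X] = μ{R ∈ A} · E X` -/

section Independence

variable [MeasurableSpace Ω] {μ : Measure Ω} {R : Ω → ℕ} {X : Ω → ℝ}

/-- `E[1_{R=k} X] = μ{R=k} · E[X]` for `X` independent of the level `R`.
[cite: Vihola2018, §4 (proof of Theorem 7: "`N_i` … independent of `(Δ_i^{(j)})`")];
[cite: McLeish2011, §2 ("`E(I(n ≤ N)/Q_n | 𝓕) = 1`")] -/
theorem integral_indicator_eq_mul (hR : Measurable R) (hX : AEStronglyMeasurable X μ)
    (hind : IndepFun R X μ) (k : ℕ) :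
    ∫ ω, (if R ω = k then (1 : ℝ) else 0) * X ω ∂μ = μ.real {ω | R ω = k} * ∫ ω, X ω ∂μ := by
  have h1 : IndepFun ((fun n : ℕ => if n = k then (1 : ℝ) else 0) ∘ R) (id ∘ X) μ :=
    hind.comp measurable_from_nat measurable_id
  have h2 := h1.integral_fun_mul_eq_mul_integral
    ((measurable_from_nat (f := fun n : ℕ => if n = k then (1 : ℝ) else 0)).comp
      hR).aestronglyMeasurable hX
  simp only [Function.comp_def, id] at h2
  rw [h2]
  congr 1
  have e : (fun ω => if R ω = k then (1 : ℝ) else 0) = {ω | R ω = k}.indicator 1 := by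
    ext ω
    simp only [Set.indicator_apply, Set.mem_setOf_eq, Pi.one_apply]
  have hs : MeasurableSet {ω | R ω = k} := hR (measurableSet_singleton k)
  rw [e]
  exact integral_indicator_one hs

/-- `E[1_{k≤R} X] = μ{k≤R} · E[X]` for `X` independent of the level `R`.
[cite: McLeish2011, §2 ("`E(I(n ≤ N)/Q_n | 𝓕) = 1`")]; [cite: RheeGlynn2012, §2 (first display:
`E Δ_n I(N ≥ n)/P(N ≥ n)`)] -/
theorem integral_indicator_le_mul (hR : Measurable R) (hX : AEStronglyMeasurable X μ)
    (hind : IndepFun R X μ) (k : ℕ) :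
    ∫ ω, (if k ≤ R ω then (1 : ℝ) else 0) * X ω ∂μ = μ.real {ω | k ≤ R ω} * ∫ ω, X ω ∂μ := by
  have h1 : IndepFun ((fun n : ℕ => if k ≤ n then (1 : ℝ) else 0) ∘ R) (id ∘ X) μ :=
    hind.comp measurable_from_nat measurable_id
  have h2 := h1.integral_fun_mul_eq_mul_integral
    ((measurable_from_nat (f := fun n : ℕ => if k ≤ n then (1 : ℝ) else 0)).comp
      hR).aestronglyMeasurable hX
  simp only [Function.comp_def, id] at h2
  rw [h2]
  congr 1
  have e : (fun ω => if k ≤ R ω then (1 : ℝ) else 0) = {ω | k ≤ R ω}.indicator 1 := by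
    ext ω
    simp only [Set.indicator_apply, Set.mem_setOf_eq, Pi.one_apply]
  have hs : MeasurableSet {ω | k ≤ R ω} := hR measurableSet_Ici
  rw [e]
  exact integral_indicator_one hs

/-- The printed hypothesis "`R` independent of the whole increment process" implies the termwise
product independence used for second moments. [cite: Vihola2018, §4 Theorem 7 (hypotheses)] -/
theorem indepFun_mul_of_indepFun_pi {Δ : ℕ → Ω → ℝ} (hind : IndepFun R (fun ω k => Δ k ω) μ)
    (i k : ℕ) : IndepFun R (fun ω => Δ i ω * Δ k ω) μ := by
  have h := hind.comp measurable_id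
    ((measurable_pi_apply i).mul (measurable_pi_apply k) :
      Measurable fun x : ℕ → ℝ => x i * x k)
  exact h

/-- … and the termwise independence used for first moments. [cite: Vihola2018, §4 Theorem 7
(hypotheses)] -/
theorem indepFun_of_indepFun_pi {Δ : ℕ → Ω → ℝ} (hind : IndepFun R (fun ω k => Δ k ω) μ)
    (k : ℕ) : IndepFun R (Δ k) μ := by
  have h := hind.comp measurable_id (measurable_pi_apply k : Measurable fun x : ℕ → ℝ => x k)
  exact h

end Independence

/-! ## The single-term estimator (Vihola's Theorem 3) -/

section SingleTerm

variable [MeasurableSpace Ω] {μ : Measure Ω} {Δ : ℕ → Ω → ℝ} {p : ℕ → ℝ} {R : Ω → ℕ}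

/-- Mean of the `k`-th summand: `E[1_{R=k} Δ_k/p_k] = E Δ_k`. [cite: Vihola2018, §4 Example 9
(`E N_i = n p_i`)] -/
theorem integral_singleTermAt {k : ℕ} (hR : Measurable R) (hΔm : Measurable (Δ k))
    (hind : IndepFun R (Δ k) μ) (hp : μ.real {ω | R ω = k} = p k) (hp0 : p k ≠ 0) :
    ∫ ω, singleTermAt Δ p R k ω ∂μ = ∫ ω, Δ k ω ∂μ := by
  have e : singleTermAt Δ p R k = fun ω => (if R ω = k then (1 : ℝ) else 0) * (Δ k ω / p k) := by
    ext ω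
    simp only [singleTermAt, ite_mul, one_mul, zero_mul]
  have hind' : IndepFun R (fun ω => Δ k ω / p k) μ :=
    hind.comp measurable_id (measurable_id.div_const (p k))
  rw [e, integral_indicator_eq_mul hR (hΔm.div_const _).aestronglyMeasurable hind' k, hp,
    integral_div, mul_div_cancel₀ _ hp0]

/-- First absolute moment of the `k`-th summand: `E|1_{R=k} Δ_k/p_k| = E|Δ_k|`.
[cite: Vihola2018, §4 Example 9] -/
theorem integral_norm_singleTermAt {k : ℕ} (hR : Measurable R) (hΔm : Measurable (Δ k))
    (hind : IndepFun R (Δ k) μ) (hp : μ.real {ω | R ω = k} = p k) (hp0 : 0 < p k) :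
    ∫ ω, ‖singleTermAt Δ p R k ω‖ ∂μ = ∫ ω, |Δ k ω| ∂μ := by
  have e : (fun ω => ‖singleTermAt Δ p R k ω‖) =
      fun ω => (if R ω = k then (1 : ℝ) else 0) * (|Δ k ω| / p k) := by
    ext ω
    by_cases h : R ω = k
    · simp [singleTermAt, h, abs_of_pos hp0]
    · simp [singleTermAt, h]
  have hind' : IndepFun R (fun ω => |Δ k ω| / p k) μ :=
    hind.comp measurable_id ((measurable_id.abs).div_const (p k) :
      Measurable fun x : ℝ => |x| / p k)
  rw [e, integral_indicator_eq_mul hR ((hΔm.abs).div_const _).aestronglyMeasurable hind' k, hp,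
    integral_div, mul_div_cancel₀ _ hp0.ne']

/-- Each summand is integrable. [cite: Vihola2018, §3 Theorem 3] -/
theorem integrable_singleTermAt {k : ℕ} (hR : Measurable R) (hΔi : Integrable (Δ k) μ) :
    Integrable (singleTermAt Δ p R k) μ := by
  rw [singleTermAt_eq_indicator]
  exact (hΔi.div_const _).indicator (hR (measurableSet_singleton k))

/-- **VIHOLA 2018, THEOREM 3 (single term estimator), first claim** — also Rhee–Glynn's single-term
estimator: if the increments have summable first absolute moments, `Σ_k E|Δ_k| < ∞` (which the
printed Condition 2 implies, `summable_integral_abs_of_cond2`), `R` is independent of each `Δ_k`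
and `p_k = μ{R = k} > 0`, then `Z⁽¹⁾ = Δ_R/p_R` is integrable and
`E Z⁽¹⁾ = Σ_k E Δ_k` (`= lim_n E Y_n = E Y`).
[cite: Vihola2018, §3 Theorem 3]; [cite: RheeGlynn2015, §1] -/
theorem hasSum_integral_singleTerm (hR : Measurable R) (hΔm : ∀ k, Measurable (Δ k))
    (hΔi : ∀ k, Integrable (Δ k) μ) (hind : ∀ k, IndepFun R (Δ k) μ)
    (hp : ∀ k, μ.real {ω | R ω = k} = p k) (hp0 : ∀ k, 0 < p k)
    (hsum : Summable fun k => ∫ ω, |Δ k ω| ∂μ) :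
    Integrable (singleTerm Δ p R) μ ∧
      HasSum (fun k => ∫ ω, Δ k ω ∂μ) (∫ ω, singleTerm Δ p R ω ∂μ) := by
  have hFi : ∀ k, Integrable (singleTermAt Δ p R k) μ :=
    fun k => integrable_singleTermAt hR (hΔi k)
  have hnorm : ∀ k, ∫ ω, ‖singleTermAt Δ p R k ω‖ ∂μ = ∫ ω, |Δ k ω| ∂μ :=
    fun k => integral_norm_singleTermAt hR (hΔm k) (hind k) (hp k) (hp0 k)
  have hsum' : Summable fun k => ∫ ω, ‖singleTermAt Δ p R k ω‖ ∂μ := by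
    simpa only [hnorm] using hsum
  have hmain := hasSum_integral_of_summable_integral_norm hFi hsum'
  have e : (fun ω => ∑' k, singleTermAt Δ p R k ω) = singleTerm Δ p R :=
    funext fun ω => (singleTerm_eq_tsum Δ p R ω).symm
  rw [e] at hmain
  have hk1 : ∀ k, ∫ ω, singleTermAt Δ p R k ω ∂μ = ∫ ω, Δ k ω ∂μ :=
    fun k => integral_singleTermAt hR (hΔm k) (hind k) (hp k) (hp0 k).ne'
  simp_rw [hk1] at hmain
  refine ⟨⟨(measurable_singleTerm hΔm hR).aestronglyMeasurable, ?_⟩, hmain⟩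
  -- finite integral: `∫⁻ ‖Z‖ₑ = Σ_k ∫⁻ ‖term_k‖ₑ = Σ_k E|Δ_k| < ∞`
  have hpt : ∀ ω, ‖singleTerm Δ p R ω‖ₑ = ∑' k, ‖singleTermAt Δ p R k ω‖ₑ := by
    intro ω
    rw [tsum_eq_single (R ω) (fun k hk => ?_)]
    · simp [singleTermAt, singleTerm]
    · have : singleTermAt Δ p R k ω = 0 := by
        simp only [singleTermAt, ite_eq_right_iff]
        exact fun h => absurd h.symm hk
      simp [this]
  unfold HasFiniteIntegral
  simp_rw [hpt]
  rw [lintegral_tsum (fun k => (measurable_singleTermAt hΔm hR k).enorm.aemeasurable)]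
  have hk2 : ∀ k, ∫⁻ ω, ‖singleTermAt Δ p R k ω‖ₑ ∂μ = ENNReal.ofReal (∫ ω, |Δ k ω| ∂μ) :=
    fun k => by rw [← ofReal_integral_norm_eq_lintegral_enorm (hFi k), hnorm k]
  simp_rw [hk2]
  rw [← ENNReal.ofReal_tsum_of_nonneg (fun k => integral_nonneg fun ω => abs_nonneg _) hsum]
  exact ENNReal.ofReal_lt_top

/-- `(E|X|)² ≤ E X²` on a probability space (variance of `|X|` is non-negative).
[cite: Vihola2018, §3 (Condition 2 ⇒ integrability, implicit)] -/
theorem sq_integral_abs_le [IsProbabilityMeasure μ] {X : Ω → ℝ} (hX : MemLp X 2 μ) :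
    (∫ ω, |X ω| ∂μ) ^ 2 ≤ ∫ ω, X ω ^ 2 ∂μ := by
  have hv := variance_nonneg |X| μ
  rw [variance_eq_sub hX.abs] at hv
  have e1 : ∫ ω, (|X| ^ 2) ω ∂μ = ∫ ω, X ω ^ 2 ∂μ := by
    refine integral_congr_ae (ae_of_all _ fun ω => ?_)
    simp only [Pi.pow_apply, Pi.abs_apply, sq_abs]
  have e2 : ∫ ω, |X| ω ∂μ = ∫ ω, |X ω| ∂μ := rfl
  rw [e1, e2] at hv
  linarith

/-- The printed CONDITION 2, `Σ_k E Δ_k²/p_k < ∞` for a (summable) probability vector `p > 0`,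
implies `Σ_k E|Δ_k| < ∞` (by `E|Δ_k| ≤ √(E Δ_k²) ≤ (E Δ_k²/p_k + p_k)/2`).
[cite: Vihola2018, §3 Condition 2] -/
theorem summable_integral_abs_of_cond2 [IsProbabilityMeasure μ] (hΔ2 : ∀ k, MemLp (Δ k) 2 μ)
    (hp0 : ∀ k, 0 < p k) (hps : Summable p)
    (hcond : Summable fun k => (∫ ω, Δ k ω ^ 2 ∂μ) / p k) :
    Summable fun k => ∫ ω, |Δ k ω| ∂μ := by
  refine Summable.of_nonneg_of_le (fun k => integral_nonneg fun ω => abs_nonneg _)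
    (fun k => ?_) ((hcond.add hps).div_const 2)
  -- `E|Δ_k| ≤ (E Δ_k²/p_k + p_k)/2`
  have h1 : (∫ ω, |Δ k ω| ∂μ) ^ 2 ≤ ∫ ω, Δ k ω ^ 2 ∂μ := sq_integral_abs_le (hΔ2 k)
  have h0 : 0 ≤ ∫ ω, |Δ k ω| ∂μ := integral_nonneg fun ω => abs_nonneg _
  have hpk := hp0 k
  have h2 : ∫ ω, Δ k ω ^ 2 ∂μ = (∫ ω, Δ k ω ^ 2 ∂μ) / p k * p k := by
    field_simp
  -- AM–GM: `a ≤ (a²/p + p)/2` whenever `a ≥ 0`, `p > 0`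
  have h3 : ∫ ω, |Δ k ω| ∂μ ≤ ((∫ ω, |Δ k ω| ∂μ) ^ 2 / p k + p k) / 2 := by
    rw [le_div_iff₀ (by norm_num : (0:ℝ) < 2)]
    have : (∫ ω, |Δ k ω| ∂μ) ^ 2 / p k + p k - (∫ ω, |Δ k ω| ∂μ) * 2 =
        ((∫ ω, |Δ k ω| ∂μ) - p k) ^ 2 / p k := by
      field_simp
      ring
    nlinarith [div_nonneg (sq_nonneg ((∫ ω, |Δ k ω| ∂μ) - p k)) hpk.le]
  calc ∫ ω, |Δ k ω| ∂μ ≤ ((∫ ω, |Δ k ω| ∂μ) ^ 2 / p k + p k) / 2 := h3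
    _ ≤ ((∫ ω, Δ k ω ^ 2 ∂μ) / p k + p k) / 2 := by
        gcongr

/-- **VIHOLA 2018, THEOREM 3, first claim, with the printed hypothesis**: under Condition 2
(`Σ_k E Δ_k²/p_k < ∞`, `p` a positive summable weight with `μ{R = k} = p_k`), `E Z⁽¹⁾ = Σ_k E Δ_k`.
[cite: Vihola2018, §3 Condition 2 and Theorem 3] -/
theorem hasSum_integral_singleTerm_of_cond2 [IsProbabilityMeasure μ] (hR : Measurable R)
    (hΔm : ∀ k, Measurable (Δ k)) (hΔ2 : ∀ k, MemLp (Δ k) 2 μ) (hind : ∀ k, IndepFun R (Δ k) μ)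
    (hp : ∀ k, μ.real {ω | R ω = k} = p k) (hp0 : ∀ k, 0 < p k) (hps : Summable p)
    (hcond : Summable fun k => (∫ ω, Δ k ω ^ 2 ∂μ) / p k) :
    Integrable (singleTerm Δ p R) μ ∧
      HasSum (fun k => ∫ ω, Δ k ω ∂μ) (∫ ω, singleTerm Δ p R ω ∂μ) :=
  hasSum_integral_singleTerm hR hΔm (fun k => (hΔ2 k).integrable one_le_two) hind hp hp0
    (summable_integral_abs_of_cond2 hΔ2 hp0 hps hcond)

/-- **VIHOLA 2018, THEOREM 3 (single term estimator), second claim**: under Condition 2,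
`E (Z⁽¹⁾)² = Σ_k E Δ_k²/p_k` (and `(Z⁽¹⁾)²` is integrable).  Proof as printed in Example 9: the
cross terms `1_{R=i}1_{R=k}`, `i ≠ k`, vanish, so `(Z⁽¹⁾)²` is the single-term estimator of the
increments `Δ_k²/p_k`, to which the first claim applies.
[cite: Vihola2018, §3 Theorem 3; §4 Example 9] -/
theorem hasSum_integral_singleTerm_sq (hR : Measurable R) (hΔm : ∀ k, Measurable (Δ k))
    (hΔ2 : ∀ k, MemLp (Δ k) 2 μ) (hind : ∀ k, IndepFun R (Δ k) μ)
    (hp : ∀ k, μ.real {ω | R ω = k} = p k) (hp0 : ∀ k, 0 < p k)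
    (hcond : Summable fun k => (∫ ω, Δ k ω ^ 2 ∂μ) / p k) :
    Integrable (fun ω => singleTerm Δ p R ω ^ 2) μ ∧
      HasSum (fun k => (∫ ω, Δ k ω ^ 2 ∂μ) / p k) (∫ ω, singleTerm Δ p R ω ^ 2 ∂μ) := by
  set Δ' : ℕ → Ω → ℝ := fun k ω => Δ k ω ^ 2 / p k with hΔ'
  have e : (fun ω => singleTerm Δ p R ω ^ 2) = singleTerm Δ' p R :=
    funext fun ω => singleTerm_sq Δ p R ω
  have hΔ'm : ∀ k, Measurable (Δ' k) := fun k => ((hΔm k).pow_const 2).div_const _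
  have hΔ'i : ∀ k, Integrable (Δ' k) μ := fun k => (hΔ2 k).integrable_sq.div_const _
  have hind' : ∀ k, IndepFun R (Δ' k) μ := fun k =>
    (hind k).comp measurable_id ((measurable_id.pow_const 2).div_const (p k) :
      Measurable fun x : ℝ => x ^ 2 / p k)
  have habs : ∀ k, ∫ ω, |Δ' k ω| ∂μ = (∫ ω, Δ k ω ^ 2 ∂μ) / p k := by
    intro k
    simp only [hΔ', abs_div, abs_of_pos (hp0 k), abs_pow, sq_abs, integral_div]
  have hsum : Summable fun k => ∫ ω, |Δ' k ω| ∂μ := by simpa only [habs] using hcond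
  obtain ⟨hint, hsumZ⟩ := hasSum_integral_singleTerm hR hΔ'm hΔ'i hind' hp hp0 hsum
  refine ⟨by rwa [e], ?_⟩
  rw [e]
  have e2 : (fun k => (∫ ω, Δ k ω ^ 2 ∂μ) / p k) = fun k => ∫ ω, Δ' k ω ∂μ := by
    ext k
    simp only [hΔ', integral_div]
  rwa [e2]

/-- **VIHOLA 2018, EXAMPLE 9 (variance of the single-term estimator)**: under Condition 2 on a
probability space, `var(Z⁽¹⁾) = Σ_k E Δ_k²/p_k − (Σ_k E Δ_k)²` ("`var(Z_iid^{(n)}) = n⁻¹(Σ_i E Δ_i²/p_i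
− (E Y)²)`" at `n = 1`). [cite: Vihola2018, §4 Example 9 (last display)] -/
theorem variance_singleTerm [IsProbabilityMeasure μ] (hR : Measurable R)
    (hΔm : ∀ k, Measurable (Δ k)) (hΔ2 : ∀ k, MemLp (Δ k) 2 μ) (hind : ∀ k, IndepFun R (Δ k) μ)
    (hp : ∀ k, μ.real {ω | R ω = k} = p k) (hp0 : ∀ k, 0 < p k) (hps : Summable p)
    (hcond : Summable fun k => (∫ ω, Δ k ω ^ 2 ∂μ) / p k) :
    variance (singleTerm Δ p R) μ =
      ∑' k, (∫ ω, Δ k ω ^ 2 ∂μ) / p k - (∑' k, ∫ ω, Δ k ω ∂μ) ^ 2 := by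
  obtain ⟨hint, h1⟩ := hasSum_integral_singleTerm_of_cond2 hR hΔm hΔ2 hind hp hp0 hps hcond
  obtain ⟨hint2, h2⟩ := hasSum_integral_singleTerm_sq hR hΔm hΔ2 hind hp hp0 hcond
  have hmem : MemLp (singleTerm Δ p R) 2 μ :=
    (memLp_two_iff_integrable_sq hint.aestronglyMeasurable).mpr hint2
  rw [variance_eq_sub hmem]
  simp only [Pi.pow_apply]
  rw [← h1.tsum_eq, ← h2.tsum_eq]

end SingleTerm

/-! ## The sum estimator (McLeish; Rhee–Glynn; Vihola's Theorem 5) -/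

section SumEstimator

variable [MeasurableSpace Ω] {μ : Measure Ω} {Δ : ℕ → Ω → ℝ} {q : ℕ → ℝ} {R : Ω → ℕ}

/-- Mean of the `k`-th summand: `E[1_{k≤R} Δ_k/q_k] = E Δ_k`. [cite: McLeish2011, §2
("`E(I(n ≤ N)/Q_n | 𝓕) = 1`")]; [cite: RheeGlynn2012, §2 (first display)] -/
theorem integral_sumTermAt {k : ℕ} (hR : Measurable R) (hΔm : Measurable (Δ k))
    (hind : IndepFun R (Δ k) μ) (hq : μ.real {ω | k ≤ R ω} = q k) (hq0 : q k ≠ 0) :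
    ∫ ω, sumTermAt Δ q R k ω ∂μ = ∫ ω, Δ k ω ∂μ := by
  have e : sumTermAt Δ q R k = fun ω => (if k ≤ R ω then (1 : ℝ) else 0) * (Δ k ω / q k) := by
    ext ω
    simp only [sumTermAt, ite_mul, one_mul, zero_mul]
  have hind' : IndepFun R (fun ω => Δ k ω / q k) μ :=
    hind.comp measurable_id (measurable_id.div_const (q k))
  rw [e, integral_indicator_le_mul hR (hΔm.div_const _).aestronglyMeasurable hind' k, hq,
    integral_div, mul_div_cancel₀ _ hq0]

/-- First absolute moment of the `k`-th summand: `E|1_{k≤R} Δ_k/q_k| = E|Δ_k|`.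
[cite: McLeish2011, §2] -/
theorem integral_norm_sumTermAt {k : ℕ} (hR : Measurable R) (hΔm : Measurable (Δ k))
    (hind : IndepFun R (Δ k) μ) (hq : μ.real {ω | k ≤ R ω} = q k) (hq0 : 0 < q k) :
    ∫ ω, ‖sumTermAt Δ q R k ω‖ ∂μ = ∫ ω, |Δ k ω| ∂μ := by
  have e : (fun ω => ‖sumTermAt Δ q R k ω‖) =
      fun ω => (if k ≤ R ω then (1 : ℝ) else 0) * (|Δ k ω| / q k) := by
    ext ω
    by_cases h : k ≤ R ω
    · simp [sumTermAt, h, abs_of_pos hq0]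
    · simp [sumTermAt, h]
  have hind' : IndepFun R (fun ω => |Δ k ω| / q k) μ :=
    hind.comp measurable_id ((measurable_id.abs).div_const (q k) :
      Measurable fun x : ℝ => |x| / q k)
  rw [e, integral_indicator_le_mul hR ((hΔm.abs).div_const _).aestronglyMeasurable hind' k, hq,
    integral_div, mul_div_cancel₀ _ hq0.ne']

/-- Each summand is integrable. [cite: Vihola2018, §3 Theorem 5] -/
theorem integrable_sumTermAt {k : ℕ} (hR : Measurable R) (hΔi : Integrable (Δ k) μ) :
    Integrable (sumTermAt Δ q R k) μ := by
  rw [sumTermAt_eq_indicator]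
  exact (hΔi.div_const _).indicator (hR measurableSet_Ici)

/-- **THE SUM ESTIMATOR IS UNBIASED** — [McLeish2011, §2]: "`Y = x₀ + Σ_{n=1}^N ∇X_n/Q_n` … is
obviously unbiased provided that it is integrable and one can interchange the sum and the expected
value"; here the interchange is justified by absolute convergence in `L¹`: if `Σ_k E|Δ_k| < ∞`, `R`
is independent of each `Δ_k` and `q_k = μ{k ≤ R} > 0`, then `Z_Σ = Σ_{k≤R} Δ_k/q_k` is integrable
and `E Z_Σ = Σ_k E Δ_k` (`= lim_n E Y_n = E Y`; Vihola's Theorem 5, first claim; Rhee–Glynn's `E Z =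
E k(X)`). [cite: McLeish2011, §2]; [cite: Vihola2018, §3 Theorem 5]; [cite: RheeGlynn2012, §2] -/
theorem hasSum_integral_sumEst (hR : Measurable R) (hΔm : ∀ k, Measurable (Δ k))
    (hΔi : ∀ k, Integrable (Δ k) μ) (hind : ∀ k, IndepFun R (Δ k) μ)
    (hq : ∀ k, μ.real {ω | k ≤ R ω} = q k) (hq0 : ∀ k, 0 < q k)
    (hsum : Summable fun k => ∫ ω, |Δ k ω| ∂μ) :
    Integrable (sumEst Δ q R) μ ∧
      HasSum (fun k => ∫ ω, Δ k ω ∂μ) (∫ ω, sumEst Δ q R ω ∂μ) := by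
  have hFi : ∀ k, Integrable (sumTermAt Δ q R k) μ :=
    fun k => integrable_sumTermAt hR (hΔi k)
  have hnorm : ∀ k, ∫ ω, ‖sumTermAt Δ q R k ω‖ ∂μ = ∫ ω, |Δ k ω| ∂μ :=
    fun k => integral_norm_sumTermAt hR (hΔm k) (hind k) (hq k) (hq0 k)
  have hsum' : Summable fun k => ∫ ω, ‖sumTermAt Δ q R k ω‖ ∂μ := by
    simpa only [hnorm] using hsum
  have hmain := hasSum_integral_of_summable_integral_norm hFi hsum'
  have e : (fun ω => ∑' k, sumTermAt Δ q R k ω) = sumEst Δ q R :=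
    funext fun ω => (sumEst_eq_tsum Δ q R ω).symm
  rw [e] at hmain
  have hk1 : ∀ k, ∫ ω, sumTermAt Δ q R k ω ∂μ = ∫ ω, Δ k ω ∂μ :=
    fun k => integral_sumTermAt hR (hΔm k) (hind k) (hq k) (hq0 k).ne'
  simp_rw [hk1] at hmain
  refine ⟨⟨(measurable_sumEst hΔm hR).aestronglyMeasurable, ?_⟩, hmain⟩
  -- finite integral: `∫⁻ ‖Z_Σ‖ₑ ≤ Σ_k ∫⁻ ‖term_k‖ₑ = Σ_k E|Δ_k| < ∞`
  have hpt : ∀ ω, ‖sumEst Δ q R ω‖ₑ ≤ ∑' k, ‖sumTermAt Δ q R k ω‖ₑ := by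
    intro ω
    rw [sumEst_eq_tsum, tsum_eq_sum (s := range (R ω + 1)) (fun k hk => ?_)]
    · calc ‖∑ k ∈ range (R ω + 1), sumTermAt Δ q R k ω‖ₑ
            ≤ ∑ k ∈ range (R ω + 1), ‖sumTermAt Δ q R k ω‖ₑ := enorm_sum_le _ _
        _ ≤ ∑' k, ‖sumTermAt Δ q R k ω‖ₑ := ENNReal.sum_le_tsum _
    · rw [mem_range, not_lt] at hk
      simp only [sumTermAt, ite_eq_right_iff]
      intro h
      exfalso
      omega
  unfold HasFiniteIntegral
  calc ∫⁻ ω, ‖sumEst Δ q R ω‖ₑ ∂μ ≤ ∫⁻ ω, ∑' k, ‖sumTermAt Δ q R k ω‖ₑ ∂μ :=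
        lintegral_mono fun ω => hpt ω
    _ = ∑' k, ∫⁻ ω, ‖sumTermAt Δ q R k ω‖ₑ ∂μ :=
        lintegral_tsum (fun k => (measurable_sumTermAt hΔm hR k).enorm.aemeasurable)
    _ = ∑' k, ENNReal.ofReal (∫ ω, |Δ k ω| ∂μ) := by
        refine tsum_congr (fun k => ?_)
        rw [← ofReal_integral_norm_eq_lintegral_enorm (hFi k), hnorm k]
    _ = ENNReal.ofReal (∑' k, ∫ ω, |Δ k ω| ∂μ) :=
        (ENNReal.ofReal_tsum_of_nonneg (fun k => integral_nonneg fun ω => abs_nonneg _) hsum).symm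
    _ < ∞ := ENNReal.ofReal_lt_top

/-- The `m`-level estimator is unbiased for `E Y_m`: `E Z_m = Σ_{k<m} E Δ_k = E Y_m` (no summability
needed). [cite: Vihola2018, §4 Example 10]; [cite: RheeGlynn2012, §2] -/
theorem integral_sumEstTrunc (hR : Measurable R) (hΔm : ∀ k, Measurable (Δ k))
    (hΔi : ∀ k, Integrable (Δ k) μ) (hind : ∀ k, IndepFun R (Δ k) μ)
    (hq : ∀ k, μ.real {ω | k ≤ R ω} = q k) (hq0 : ∀ k, 0 < q k) (m : ℕ) :
    ∫ ω, sumEstTrunc Δ q R m ω ∂μ = ∫ ω, partialSum Δ m ω ∂μ := by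
  unfold sumEstTrunc partialSum
  rw [integral_finsetSum _ (fun k _ => integrable_sumTermAt hR (hΔi k)),
    integral_finsetSum _ (fun k _ => hΔi k)]
  exact sum_congr rfl fun k _ => integral_sumTermAt hR (hΔm k) (hind k) (hq k) (hq0 k).ne'

/-- `E[term_i · term_k] = E[Δ_iΔ_k]/q_i` for `i ≤ k`. [cite: RheeGlynn2012, §2 (expansion of
`E Z²`: "`2 Σ_i Σ_{j>i} E Δ_iΔ_j/P(N ≥ i)`" — in our indexing the surviving weight is that of the
LARGER index, `q_k = μ{k ≤ R}`, divided by `q_i q_k`)] -/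
theorem integral_sumTermAt_mul {i k : ℕ} (hR : Measurable R) (hΔm : ∀ k, Measurable (Δ k))
    (hind2 : IndepFun R (fun ω => Δ i ω * Δ k ω) μ)
    (hq : ∀ k, μ.real {ω | k ≤ R ω} = q k) (hq0 : ∀ k, 0 < q k) (hik : i ≤ k) :
    ∫ ω, sumTermAt Δ q R i ω * sumTermAt Δ q R k ω ∂μ = (∫ ω, Δ i ω * Δ k ω ∂μ) / q i := by
  simp_rw [sumTermAt_mul_sumTermAt Δ q R hik]
  have hind' : IndepFun R (fun ω => Δ i ω * Δ k ω / (q i * q k)) μ :=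
    hind2.comp measurable_id (measurable_id.div_const (q i * q k))
  have hXm : AEStronglyMeasurable (fun ω => Δ i ω * Δ k ω / (q i * q k)) μ := by
    exact (((hΔm i).mul (hΔm k)).div_const _).aestronglyMeasurable
  rw [integral_indicator_le_mul hR hXm hind' k, hq, integral_div, mul_comm, div_mul_eq_mul_div,
    mul_div_mul_right _ _ (hq0 k).ne']

/-- Each summand is square integrable when the increment is. [cite: Vihola2018, §3 Theorem 5] -/
theorem memLp_sumTermAt (hR : Measurable R) (hΔ2 : ∀ k, MemLp (Δ k) 2 μ) (k : ℕ) :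
    MemLp (sumTermAt Δ q R k) 2 μ := by
  have h : MemLp (fun ω => Δ k ω / q k) 2 μ := by
    simpa only [div_eq_mul_inv] using (hΔ2 k).mul_const (q k)⁻¹
  rw [sumTermAt_eq_indicator]
  exact h.indicator (hR measurableSet_Ici)

/-- `Z_m` is square integrable when the increments are. [cite: Vihola2018, §3 Theorem 5] -/
theorem memLp_sumEstTrunc (hR : Measurable R) (hΔ2 : ∀ k, MemLp (Δ k) 2 μ) (m : ℕ) :
    MemLp (sumEstTrunc Δ q R m) 2 μ := by
  have h : ∀ k, MemLp (sumTermAt Δ q R k) 2 μ := fun k => memLp_sumTermAt hR hΔ2 k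
  unfold sumEstTrunc
  exact memLp_finsetSum (range m) (fun k _ => h k)

/-- **SECOND MOMENT OF THE SUM ESTIMATOR AT `m` LEVELS** (Rhee–Glynn's expansion): if `R` is
independent of the products `Δ_iΔ_k`, the increments are square integrable and `q_k = μ{k ≤ R} > 0`,
then `E Z_m² = Σ_{i<m} E Δ_i²/q_i + 2 Σ_{i<m} Σ_{i<j<m} E Δ_iΔ_j/q_i` ("`E Z² = … + Σ_i E Δ_i²/P(N ≥ i)
+ … + 2 Σ_i Σ_{j>i} E Δ_iΔ_j/P(N ≥ i)`").  Proof by induction on `m`: `Z_{m+1} = Z_m + term_m` and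
`E[Z_m term_m] = Σ_{i<m} E Δ_iΔ_m/q_i`, `E term_m² = E Δ_m²/q_m`.
[cite: RheeGlynn2012, §2 (display for `E Z²`)] -/
theorem integral_sumEstTrunc_sq (hR : Measurable R) (hΔm : ∀ k, Measurable (Δ k))
    (hΔ2 : ∀ k, MemLp (Δ k) 2 μ) (hind2 : ∀ i k, IndepFun R (fun ω => Δ i ω * Δ k ω) μ)
    (hq : ∀ k, μ.real {ω | k ≤ R ω} = q k) (hq0 : ∀ k, 0 < q k) (m : ℕ) :
    ∫ ω, sumEstTrunc Δ q R m ω ^ 2 ∂μ =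
      ∑ i ∈ range m, (∫ ω, Δ i ω ^ 2 ∂μ) / q i +
        2 * ∑ i ∈ range m, ∑ j ∈ Ico (i + 1) m, (∫ ω, Δ i ω * Δ j ω ∂μ) / q i := by
  have hT2 : ∀ k, MemLp (sumTermAt Δ q R k) 2 μ := fun k => memLp_sumTermAt hR hΔ2 k
  induction m with
  | zero => simp [sumEstTrunc]
  | succ m ih =>
    have hS2 : MemLp (sumEstTrunc Δ q R m) 2 μ := memLp_sumEstTrunc hR hΔ2 m
    -- expand the square of `Z_{m+1} = Z_m + term_m`
    have e : (fun ω => sumEstTrunc Δ q R (m + 1) ω ^ 2) = fun ω =>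
        sumEstTrunc Δ q R m ω ^ 2 + 2 * (sumEstTrunc Δ q R m ω * sumTermAt Δ q R m ω) +
          sumTermAt Δ q R m ω ^ 2 := by
      ext ω
      simp only [sumEstTrunc, sum_range_succ]
      ring
    have hi1 : Integrable (fun ω => sumEstTrunc Δ q R m ω ^ 2) μ := hS2.integrable_sq
    have hi2 : Integrable (fun ω => sumEstTrunc Δ q R m ω * sumTermAt Δ q R m ω) μ :=
      hS2.integrable_mul (hT2 m)
    have hi3 : Integrable (fun ω => sumTermAt Δ q R m ω ^ 2) μ := (hT2 m).integrable_sq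
    have hi12 : Integrable (fun ω => sumEstTrunc Δ q R m ω ^ 2 +
        2 * (sumEstTrunc Δ q R m ω * sumTermAt Δ q R m ω)) μ := hi1.add (hi2.const_mul 2)
    rw [e, integral_add hi12 hi3, integral_add hi1 (hi2.const_mul 2), integral_const_mul, ih]
    -- the cross term
    have hcross : ∫ ω, sumEstTrunc Δ q R m ω * sumTermAt Δ q R m ω ∂μ =
        ∑ i ∈ range m, (∫ ω, Δ i ω * Δ m ω ∂μ) / q i := by
      have e2 : (fun ω => sumEstTrunc Δ q R m ω * sumTermAt Δ q R m ω) =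
          fun ω => ∑ i ∈ range m, sumTermAt Δ q R i ω * sumTermAt Δ q R m ω := by
        ext ω
        simp only [sumEstTrunc, sum_mul]
      rw [e2, integral_finsetSum (range m)
        (f := fun i ω => sumTermAt Δ q R i ω * sumTermAt Δ q R m ω)
        (fun i _ => (hT2 i).integrable_mul (hT2 m))]
      refine sum_congr rfl (fun i hi => ?_)
      rw [mem_range] at hi
      exact integral_sumTermAt_mul hR hΔm (hind2 i m) hq hq0 hi.le
    -- the square term
    have hsq : ∫ ω, sumTermAt Δ q R m ω ^ 2 ∂μ = (∫ ω, Δ m ω ^ 2 ∂μ) / q m := by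
      have e3 : (fun ω => sumTermAt Δ q R m ω ^ 2) =
          fun ω => sumTermAt Δ q R m ω * sumTermAt Δ q R m ω := by
        ext ω
        ring
      rw [e3, integral_sumTermAt_mul hR hΔm (hind2 m m) hq hq0 le_rfl]
      simp only [sq]
    rw [hcross, hsq, sum_range_succ, sum_range_succ, Ico_self, sum_empty, add_zero]
    -- bookkeeping of the double sum: `Ico (i+1) (m+1) = Ico (i+1) m ∪ {m}` for `i < m`
    have hIco : ∑ i ∈ range m, ∑ j ∈ Ico (i + 1) (m + 1), (∫ ω, Δ i ω * Δ j ω ∂μ) / q i =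
        ∑ i ∈ range m, ∑ j ∈ Ico (i + 1) m, (∫ ω, Δ i ω * Δ j ω ∂μ) / q i +
          ∑ i ∈ range m, (∫ ω, Δ i ω * Δ m ω ∂μ) / q i := by
      rw [← sum_add_distrib]
      refine sum_congr rfl (fun i hi => ?_)
      rw [mem_range] at hi
      rw [sum_Ico_succ_top (Nat.succ_le_of_lt hi)]
    rw [hIco]
    ring

/-- The telescoping identity behind the "coupled-sum" form: for `i < m`,
`E(Y_i − Y_m)² − E(Y_{i+1} − Y_m)² = E Δ_i² + 2 Σ_{i<j<m} E Δ_iΔ_j` ("because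
`Δ_i² + 2Δ_i(Y_m − Y_i) = (Y_{i−1} − Y_m)² − (Y_i − Y_m)²`"). [cite: Vihola2018, §4 Example 10] -/
theorem integral_partialSum_sq_sub (hΔ2 : ∀ k, MemLp (Δ k) 2 μ) {i m : ℕ} (him : i < m) :
    (∫ ω, (partialSum Δ i ω - partialSum Δ m ω) ^ 2 ∂μ) -
        ∫ ω, (partialSum Δ (i + 1) ω - partialSum Δ m ω) ^ 2 ∂μ =
      (∫ ω, Δ i ω ^ 2 ∂μ) + 2 * ∑ j ∈ Ico (i + 1) m, ∫ ω, Δ i ω * Δ j ω ∂μ := by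
  -- pointwise: `(Y_i − Y_m)² − (Y_{i+1} − Y_m)² = Δ_i² + 2 Δ_i Σ_{i<j<m} Δ_j`
  have hpt : ∀ ω, (partialSum Δ i ω - partialSum Δ m ω) ^ 2 =
      (partialSum Δ (i + 1) ω - partialSum Δ m ω) ^ 2 +
        (Δ i ω ^ 2 + 2 * ∑ j ∈ Ico (i + 1) m, Δ i ω * Δ j ω) := by
    intro ω
    have hm : partialSum Δ m ω = partialSum Δ (i + 1) ω + ∑ j ∈ Ico (i + 1) m, Δ j ω := by
      unfold partialSum
      rw [sum_range_add_sum_Ico _ (Nat.succ_le_of_lt him)]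
    rw [hm, partialSum_succ, ← mul_sum]
    ring
  have hY2 : ∀ n, MemLp (partialSum Δ n) 2 μ := by
    intro n
    unfold partialSum
    exact memLp_finsetSum (range n) (fun k _ => hΔ2 k)
  have hiA : Integrable (fun ω => (partialSum Δ (i + 1) ω - partialSum Δ m ω) ^ 2) μ :=
    ((hY2 (i + 1)).sub (hY2 m)).integrable_sq
  have hiB : Integrable (fun ω => Δ i ω ^ 2) μ := (hΔ2 i).integrable_sq
  have hiC : Integrable (fun ω => ∑ j ∈ Ico (i + 1) m, Δ i ω * Δ j ω) μ :=
    integrable_finsetSum _ (fun j _ => (hΔ2 i).integrable_mul (hΔ2 j))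
  have hiBC : Integrable (fun ω => Δ i ω ^ 2 + 2 * ∑ j ∈ Ico (i + 1) m, Δ i ω * Δ j ω) μ :=
    hiB.add (hiC.const_mul 2)
  simp_rw [hpt]
  rw [integral_add hiA hiBC, integral_add hiB (hiC.const_mul 2),
    integral_const_mul, integral_finsetSum (Ico (i + 1) m) (f := fun j ω => Δ i ω * Δ j ω)
      (fun j _ => (hΔ2 i).integrable_mul (hΔ2 j))]
  ring

/-- **RHEE–GLYNN 2015, THEOREM 1 / VIHOLA 2018, EXAMPLE 10 — the "coupled-sum" second moment at
`m` levels**: `E Z_m² = Σ_{i<m} (E(Y_i − Y_m)² − E(Y_{i+1} − Y_m)²)/q_i` (printed: "`E Y² = Σ_n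
(E|S − S_{n−1}|² − E|S − S_n|²)/P(N ≥ n)`", here with `S = S_m = Y_m` the last level; Vihola:
"`v_{ℓ,m} = Σ_{i=ℓ+1}^m (E(Y_{i−1} − Y_m)² − E(Y_i − Y_m)²)/p̃_i − (E Y_m − E Y_ℓ)²`" at `ℓ = 0`,
`n = 1`, where `v_{0,m} + (E Y_m)²` is the second moment).  The infinite-level statement under
`Σ_n E|S − S_{n−1}|²/P(N ≥ n) < ∞` is `hasSum_integral_sumEst_sq` below.
[cite: RheeGlynn2015, Theorem 1]; [cite: Vihola2018, §4 Example 10]; [cite: JacobThiery2015, §1.2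
Theorem 1.1 (quotation of Rhee–Glynn's Theorem 1)] -/
theorem integral_sumEstTrunc_sq_telescope (hR : Measurable R) (hΔm : ∀ k, Measurable (Δ k))
    (hΔ2 : ∀ k, MemLp (Δ k) 2 μ) (hind2 : ∀ i k, IndepFun R (fun ω => Δ i ω * Δ k ω) μ)
    (hq : ∀ k, μ.real {ω | k ≤ R ω} = q k) (hq0 : ∀ k, 0 < q k) (m : ℕ) :
    ∫ ω, sumEstTrunc Δ q R m ω ^ 2 ∂μ =
      ∑ i ∈ range m, ((∫ ω, (partialSum Δ i ω - partialSum Δ m ω) ^ 2 ∂μ) -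
        ∫ ω, (partialSum Δ (i + 1) ω - partialSum Δ m ω) ^ 2 ∂μ) / q i := by
  rw [integral_sumEstTrunc_sq hR hΔm hΔ2 hind2 hq hq0 m, mul_sum, ← sum_add_distrib]
  refine sum_congr rfl (fun i hi => ?_)
  rw [mem_range] at hi
  rw [integral_partialSum_sq_sub hΔ2 hi, add_div]
  congr 1
  rw [mul_sum, mul_sum, sum_div]
  exact sum_congr rfl (fun j _ => by ring)

/-- **VARIANCE OF THE `m`-LEVEL SUM ESTIMATOR** on a probability space:
`var(Z_m) = Σ_{i<m} (E(Y_i − Y_m)² − E(Y_{i+1} − Y_m)²)/q_i − (E Y_m)²` (Vihola's `v_{0,m}` at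
`n = 1`). [cite: Vihola2018, §4 Example 10 (display for `v_{ℓ,m}`)] -/
theorem variance_sumEstTrunc [IsProbabilityMeasure μ] (hR : Measurable R)
    (hΔm : ∀ k, Measurable (Δ k)) (hΔ2 : ∀ k, MemLp (Δ k) 2 μ)
    (hind : ∀ k, IndepFun R (Δ k) μ) (hind2 : ∀ i k, IndepFun R (fun ω => Δ i ω * Δ k ω) μ)
    (hq : ∀ k, μ.real {ω | k ≤ R ω} = q k) (hq0 : ∀ k, 0 < q k) (m : ℕ) :
    variance (sumEstTrunc Δ q R m) μ =
      ∑ i ∈ range m, ((∫ ω, (partialSum Δ i ω - partialSum Δ m ω) ^ 2 ∂μ) -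
          ∫ ω, (partialSum Δ (i + 1) ω - partialSum Δ m ω) ^ 2 ∂μ) / q i -
        (∫ ω, partialSum Δ m ω ∂μ) ^ 2 := by
  rw [variance_eq_sub (memLp_sumEstTrunc hR hΔ2 m)]
  simp only [Pi.pow_apply]
  rw [← integral_sumEstTrunc hR hΔm (fun k => (hΔ2 k).integrable one_le_two) hind hq hq0 m,
    ← integral_sumEstTrunc_sq_telescope hR hΔm hΔ2 hind2 hq hq0 m]

end SumEstimator

/-! ## The coupled sum with infinitely many levels (Rhee–Glynn 2015, Theorem 1; Vihola 2018,
Theorem 5 with Condition 4 (i)) -/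

section InfiniteLevel

open Filter
open scoped Topology

variable [MeasurableSpace Ω] {μ : Measure Ω} {Δ : ℕ → Ω → ℝ} {q : ℕ → ℝ} {R : Ω → ℕ}

/-- Two-index version of `integral_sumEstTrunc_sq`: for `m ≤ n`,
`E(Z_n − Z_m)² = Σ_{m≤i<n} E Δ_i²/q_i + 2 Σ_{m≤i<n} Σ_{i<j<n} E Δ_iΔ_j/q_i`
(Vihola: "`E(Z_m − Z_ℓ)² = Σ_{i,k=ℓ+1}^m E[(Z_i − Z_{i−1})(Z_k − Z_{k−1})]`").
[cite: Vihola2018, Appendix A (proof of Theorem 7, display for `E(Z_m − Z_ℓ)²`) and §4 Example 10] -/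
theorem integral_sub_sumEstTrunc_sq (hR : Measurable R) (hΔm : ∀ k, Measurable (Δ k))
    (hΔ2 : ∀ k, MemLp (Δ k) 2 μ) (hind2 : ∀ i k, IndepFun R (fun ω => Δ i ω * Δ k ω) μ)
    (hq : ∀ k, μ.real {ω | k ≤ R ω} = q k) (hq0 : ∀ k, 0 < q k) {m n : ℕ} (hmn : m ≤ n) :
    ∫ ω, (sumEstTrunc Δ q R n ω - sumEstTrunc Δ q R m ω) ^ 2 ∂μ =
      ∑ i ∈ Ico m n, (∫ ω, Δ i ω ^ 2 ∂μ) / q i +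
        2 * ∑ i ∈ Ico m n, ∑ j ∈ Ico (i + 1) n, (∫ ω, Δ i ω * Δ j ω ∂μ) / q i := by
  have hT2 : ∀ k, MemLp (sumTermAt Δ q R k) 2 μ := fun k => memLp_sumTermAt hR hΔ2 k
  induction n, hmn using Nat.le_induction with
  | base => simp
  | succ n hmn ih =>
    have hS2 : MemLp (fun ω => sumEstTrunc Δ q R n ω - sumEstTrunc Δ q R m ω) 2 μ :=
      (memLp_sumEstTrunc hR hΔ2 n).sub (memLp_sumEstTrunc hR hΔ2 m)
    have e : (fun ω => (sumEstTrunc Δ q R (n + 1) ω - sumEstTrunc Δ q R m ω) ^ 2) = fun ω =>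
        (sumEstTrunc Δ q R n ω - sumEstTrunc Δ q R m ω) ^ 2 +
          2 * ((sumEstTrunc Δ q R n ω - sumEstTrunc Δ q R m ω) * sumTermAt Δ q R n ω) +
          sumTermAt Δ q R n ω ^ 2 := by
      ext ω
      simp only [sumEstTrunc, sum_range_succ]
      ring
    have hi1 : Integrable (fun ω => (sumEstTrunc Δ q R n ω - sumEstTrunc Δ q R m ω) ^ 2) μ :=
      hS2.integrable_sq
    have hi2 : Integrable
        (fun ω => (sumEstTrunc Δ q R n ω - sumEstTrunc Δ q R m ω) * sumTermAt Δ q R n ω) μ :=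
      hS2.integrable_mul (hT2 n)
    have hi3 : Integrable (fun ω => sumTermAt Δ q R n ω ^ 2) μ := (hT2 n).integrable_sq
    have hi12 : Integrable (fun ω => (sumEstTrunc Δ q R n ω - sumEstTrunc Δ q R m ω) ^ 2 +
        2 * ((sumEstTrunc Δ q R n ω - sumEstTrunc Δ q R m ω) * sumTermAt Δ q R n ω)) μ :=
      hi1.add (hi2.const_mul 2)
    rw [e, integral_add hi12 hi3, integral_add hi1 (hi2.const_mul 2), integral_const_mul, ih]
    -- the cross term `E[(Z_n − Z_m) term_n] = Σ_{m ≤ i < n} E Δ_iΔ_n/q_i`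
    have hcross :
        ∫ ω, (sumEstTrunc Δ q R n ω - sumEstTrunc Δ q R m ω) * sumTermAt Δ q R n ω ∂μ =
          ∑ i ∈ Ico m n, (∫ ω, Δ i ω * Δ n ω ∂μ) / q i := by
      have e2 :
          (fun ω => (sumEstTrunc Δ q R n ω - sumEstTrunc Δ q R m ω) * sumTermAt Δ q R n ω) =
            fun ω => ∑ i ∈ Ico m n, sumTermAt Δ q R i ω * sumTermAt Δ q R n ω := by
        ext ω
        simp only [sumEstTrunc]
        rw [← sum_Ico_eq_sub _ hmn, sum_mul]
      rw [e2, integral_finsetSum (Ico m n)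
        (f := fun i ω => sumTermAt Δ q R i ω * sumTermAt Δ q R n ω)
        (fun i _ => (hT2 i).integrable_mul (hT2 n))]
      refine sum_congr rfl (fun i hi => ?_)
      rw [mem_Ico] at hi
      exact integral_sumTermAt_mul hR hΔm (hind2 i n) hq hq0 hi.2.le
    -- the square term
    have hsq : ∫ ω, sumTermAt Δ q R n ω ^ 2 ∂μ = (∫ ω, Δ n ω ^ 2 ∂μ) / q n := by
      have e3 : (fun ω => sumTermAt Δ q R n ω ^ 2) =
          fun ω => sumTermAt Δ q R n ω * sumTermAt Δ q R n ω := by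
        ext ω
        ring
      rw [e3, integral_sumTermAt_mul hR hΔm (hind2 n n) hq hq0 le_rfl]
      simp only [sq]
    rw [hcross, hsq, sum_Ico_succ_top hmn, sum_Ico_succ_top hmn, Ico_self, sum_empty, add_zero]
    have hIco : ∑ i ∈ Ico m n, ∑ j ∈ Ico (i + 1) (n + 1), (∫ ω, Δ i ω * Δ j ω ∂μ) / q i =
        ∑ i ∈ Ico m n, ∑ j ∈ Ico (i + 1) n, (∫ ω, Δ i ω * Δ j ω ∂μ) / q i +
          ∑ i ∈ Ico m n, (∫ ω, Δ i ω * Δ n ω ∂μ) / q i := by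
      rw [← sum_add_distrib]
      refine sum_congr rfl (fun i hi => ?_)
      rw [mem_Ico] at hi
      rw [sum_Ico_succ_top (Nat.succ_le_of_lt hi.2)]
    rw [hIco]
    ring

/-- Telescoped two-index form (Vihola's `v_{ℓ,m}` for the coupled sum, at `n = 1`): for `m ≤ n`,
`E(Z_n − Z_m)² = Σ_{m≤i<n} (E(Y_i − Y_n)² − E(Y_{i+1} − Y_n)²)/q_i`.
[cite: Vihola2018, §4 Example 10 (display for `v_{ℓ,m}` under Condition 4 (i))] -/
theorem integral_sub_sumEstTrunc_sq_telescope (hR : Measurable R) (hΔm : ∀ k, Measurable (Δ k))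
    (hΔ2 : ∀ k, MemLp (Δ k) 2 μ) (hind2 : ∀ i k, IndepFun R (fun ω => Δ i ω * Δ k ω) μ)
    (hq : ∀ k, μ.real {ω | k ≤ R ω} = q k) (hq0 : ∀ k, 0 < q k) {m n : ℕ} (hmn : m ≤ n) :
    ∫ ω, (sumEstTrunc Δ q R n ω - sumEstTrunc Δ q R m ω) ^ 2 ∂μ =
      ∑ i ∈ Ico m n, ((∫ ω, (partialSum Δ i ω - partialSum Δ n ω) ^ 2 ∂μ) -
        ∫ ω, (partialSum Δ (i + 1) ω - partialSum Δ n ω) ^ 2 ∂μ) / q i := by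
  rw [integral_sub_sumEstTrunc_sq hR hΔm hΔ2 hind2 hq hq0 hmn, mul_sum, ← sum_add_distrib]
  refine sum_congr rfl (fun i hi => ?_)
  rw [mem_Ico] at hi
  rw [integral_partialSum_sq_sub hΔ2 hi.2, add_div]
  congr 1
  rw [mul_sum, mul_sum, sum_div]
  exact sum_congr rfl (fun j _ => by ring)

/-- Summation by parts on an interval: `Σ_{m≤i<n} (b_i − b_{i+1})/q_i = b_m/q_m − b_n/q_n +
Σ_{m≤i<n} b_{i+1}(1/q_{i+1} − 1/q_i)` (the rearrangement behind Vihola's bound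
"`v_{m_k,m_{k+j}} ≤ 4 Σ_{i>m_k} E(Y_{i−1} − Y)²/p̃_i`"). [cite: Vihola2018, §4 Example 10] -/
theorem sum_Ico_sub_div (b q : ℕ → ℝ) {m n : ℕ} (hmn : m ≤ n) :
    ∑ i ∈ Ico m n, (b i - b (i + 1)) / q i =
      b m / q m - b n / q n + ∑ i ∈ Ico m n, b (i + 1) * (1 / q (i + 1) - 1 / q i) := by
  induction n, hmn using Nat.le_induction with
  | base => simp
  | succ n hmn ih =>
    rw [sum_Ico_succ_top hmn, sum_Ico_succ_top hmn, ih]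
    ring

/-- Telescoping on an interval: `Σ_{m≤i<n} (f_{i+1} − f_i) = f_n − f_m`.
[cite: Vihola2018, §4 Example 10] -/
theorem sum_Ico_sub_telescope (f : ℕ → ℝ) {m n : ℕ} (hmn : m ≤ n) :
    ∑ i ∈ Ico m n, (f (i + 1) - f i) = f n - f m := by
  induction n, hmn using Nat.le_induction with
  | base => simp
  | succ n hmn ih =>
    rw [sum_Ico_succ_top hmn, ih]
    ring

/-- The summation-by-parts ESTIMATE behind Vihola's Cauchy bound, as a statement about real
sequences: if `q > 0` is non-increasing, `a ≥ 0`, `b_n = 0` and `b_i ≤ 2a_i + 2a_n` for all `i`, then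
`Σ_{m≤i<n} (b_i − b_{i+1})/q_i ≤ 4 Σ_{m≤i≤n} a_i/q_i` (used with `b_i = E(Y_i − Y_n)²`,
`a_i = E(Y_i − S)²`). [cite: Vihola2018, §4 Example 10 ("`v_{m_k,m_{k+j}} ≤ 4 Σ …`")] -/
theorem sum_Ico_sub_div_le {a b q : ℕ → ℝ} (hq0 : ∀ k, 0 < q k) (hqa : Antitone q)
    (ha0 : ∀ i, 0 ≤ a i) {m n : ℕ} (hmn : m ≤ n) (hbn : b n = 0)
    (hb : ∀ i, b i ≤ 2 * a i + 2 * a n) :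
    ∑ i ∈ Ico m n, (b i - b (i + 1)) / q i ≤ 4 * ∑ i ∈ Ico m (n + 1), a i / q i := by
  set w : ℕ → ℝ := fun i => 1 / q (i + 1) - 1 / q i with hw_def
  have hc0 : ∀ i, 0 ≤ a i / q i := fun i => div_nonneg (ha0 i) (hq0 i).le
  have hw0 : ∀ i, 0 ≤ w i := fun i =>
    sub_nonneg.mpr (one_div_le_one_div_of_le (hq0 _) (hqa (Nat.le_succ i)))
  have hw1 : ∀ i, w i ≤ 1 / q (i + 1) := fun i => sub_le_self _ (one_div_pos.mpr (hq0 i)).le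
  have htw : ∑ i ∈ Ico m n, w i = 1 / q n - 1 / q m := sum_Ico_sub_telescope (fun i => 1 / q i) hmn
  rw [sum_Ico_sub_div b q hmn, hbn, zero_div, sub_zero]
  have h1 : b m / q m ≤ 2 * (a m / q m) + 2 * a n * (1 / q m) := by
    calc b m / q m ≤ (2 * a m + 2 * a n) / q m :=
          div_le_div_of_nonneg_right (hb m) (hq0 m).le
      _ = 2 * (a m / q m) + 2 * a n * (1 / q m) := by ring
  have h2 : ∑ i ∈ Ico m n, b (i + 1) * w i ≤
      2 * ∑ i ∈ Ico m n, a (i + 1) / q (i + 1) + 2 * a n * (1 / q n - 1 / q m) := by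
    have hA : ∑ i ∈ Ico m n, b (i + 1) * w i ≤ ∑ i ∈ Ico m n, (2 * a (i + 1) + 2 * a n) * w i :=
      sum_le_sum fun i _ => mul_le_mul_of_nonneg_right (hb (i + 1)) (hw0 i)
    have hB : ∑ i ∈ Ico m n, (2 * a (i + 1) + 2 * a n) * w i =
        2 * ∑ i ∈ Ico m n, a (i + 1) * w i + 2 * a n * ∑ i ∈ Ico m n, w i := by
      rw [mul_sum, mul_sum, ← sum_add_distrib]
      exact sum_congr rfl (fun i _ => by ring)
    have hC : ∑ i ∈ Ico m n, a (i + 1) * w i ≤ ∑ i ∈ Ico m n, a (i + 1) / q (i + 1) := by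
      refine sum_le_sum fun i _ => ?_
      calc a (i + 1) * w i ≤ a (i + 1) * (1 / q (i + 1)) :=
            mul_le_mul_of_nonneg_left (hw1 i) (ha0 _)
        _ = a (i + 1) / q (i + 1) := mul_one_div _ _
    rw [htw] at hB
    linarith
  have h3 : ∑ i ∈ Ico m n, a (i + 1) / q (i + 1) = ∑ i ∈ Ico (m + 1) (n + 1), a i / q i :=
    sum_Ico_add' (fun i => a i / q i) m n 1
  have h4 : a m / q m + ∑ i ∈ Ico (m + 1) (n + 1), a i / q i = ∑ i ∈ Ico m (n + 1), a i / q i :=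
    (sum_eq_sum_Ico_succ_bot (Nat.lt_succ_of_le hmn) (fun i => a i / q i)).symm
  have h5 : a n / q n ≤ ∑ i ∈ Ico m (n + 1), a i / q i :=
    single_le_sum (f := fun i => a i / q i) (fun i _ => hc0 i)
      (mem_Ico.mpr ⟨hmn, Nat.lt_succ_self n⟩)
  have h6 : a n * (1 / q n) = a n / q n := mul_one_div _ _
  nlinarith [h1, h2, h3, h4, h5, h6, ha0 n, (one_div_pos.mpr (hq0 m)).le]

/-- The survival weights `q_k = μ{k ≤ R}` are non-increasing. [cite: Vihola2018, §3 Condition 4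
(`p̃_i = Σ_{j≥i} p_j`)] -/
theorem antitone_of_measureReal_le [IsFiniteMeasure μ] (hq : ∀ k, μ.real {ω | k ≤ R ω} = q k) :
    Antitone q := by
  intro k l hkl
  rw [← hq k, ← hq l]
  exact measureReal_mono (fun ω (h : l ≤ R ω) => hkl.trans h)

/-- **VIHOLA'S CAUCHY BOUND FOR THE COUPLED SUM** — [Vihola2018, §4 Example 10]: "`v_{m_k,m_{k+j}}
≤ 4 Σ_{i=m_k+1}^∞ E(Y_{i−1} − Y)²/p̃_i`"; here for ALL `m ≤ n` and with the finite window: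
`E(Z_n − Z_m)² ≤ 4 Σ_{m ≤ i ≤ n} E(Y_i − S)²/q_i` for any square-integrable `S`
(by summation by parts, `q` non-increasing, and `E(Y_i − Y_n)² ≤ 2E(Y_i − S)² + 2E(Y_n − S)²`).
[cite: Vihola2018, §4 Example 10] -/
theorem integral_sub_sumEstTrunc_sq_le [IsFiniteMeasure μ] (hR : Measurable R)
    (hΔm : ∀ k, Measurable (Δ k)) (hΔ2 : ∀ k, MemLp (Δ k) 2 μ)
    (hind2 : ∀ i k, IndepFun R (fun ω => Δ i ω * Δ k ω) μ)
    (hq : ∀ k, μ.real {ω | k ≤ R ω} = q k) (hq0 : ∀ k, 0 < q k) {S : Ω → ℝ} (hS : MemLp S 2 μ)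
    {m n : ℕ} (hmn : m ≤ n) :
    ∫ ω, (sumEstTrunc Δ q R n ω - sumEstTrunc Δ q R m ω) ^ 2 ∂μ ≤
      4 * ∑ i ∈ Ico m (n + 1), (∫ ω, (partialSum Δ i ω - S ω) ^ 2 ∂μ) / q i := by
  set a : ℕ → ℝ := fun i => ∫ ω, (partialSum Δ i ω - S ω) ^ 2 ∂μ with ha_def
  set b : ℕ → ℝ := fun i => ∫ ω, (partialSum Δ i ω - partialSum Δ n ω) ^ 2 ∂μ with hb_def
  have hqa : Antitone q := antitone_of_measureReal_le hq
  have hY2 : ∀ i, MemLp (partialSum Δ i) 2 μ := by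
    intro i
    unfold partialSum
    exact memLp_finsetSum (range i) (fun k _ => hΔ2 k)
  have ha0 : ∀ i, 0 ≤ a i := fun i => integral_nonneg fun ω => sq_nonneg _
  have hb_le : ∀ i, b i ≤ 2 * a i + 2 * a n := by
    intro i
    have hiA : Integrable (fun ω => (partialSum Δ i ω - S ω) ^ 2) μ :=
      ((hY2 i).sub hS).integrable_sq
    have hiB : Integrable (fun ω => (partialSum Δ n ω - S ω) ^ 2) μ :=
      ((hY2 n).sub hS).integrable_sq
    calc b i ≤ ∫ ω, (2 * (partialSum Δ i ω - S ω) ^ 2 + 2 * (partialSum Δ n ω - S ω) ^ 2) ∂μ := by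
          refine integral_mono ((hY2 i).sub (hY2 n)).integrable_sq
            ((hiA.const_mul 2).add (hiB.const_mul 2)) (fun ω => ?_)
          nlinarith [sq_nonneg ((partialSum Δ i ω - S ω) + (partialSum Δ n ω - S ω))]
      _ = 2 * a i + 2 * a n := by
          rw [integral_add (hiA.const_mul 2) (hiB.const_mul 2), integral_const_mul,
            integral_const_mul]
  have hbn : b n = 0 := by simp [hb_def]
  rw [integral_sub_sumEstTrunc_sq_telescope hR hΔm hΔ2 hind2 hq hq0 hmn]
  exact sum_Ico_sub_div_le hq0 hqa ha0 hmn hbn hb_le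

/-- **FATOU STEP (generic)**: if the truncations satisfy a uniform Cauchy bound
`E(Z_n − Z_m)² ≤ B` for all `n ≥ m`, then `Z_Σ − Z_m ∈ L²` with `E(Z_Σ − Z_m)² ≤ B` — because at
every sample point `Z_n = Z_Σ` for `n > R`, so `(Z_Σ − Z_m)² = liminf_n (Z_n − Z_m)²` and Fatou's
lemma applies (Vihola: "`Z_{m_i} → Z` a.s., and therefore `Z_{m_i} → Z` in `L²`").  No independence
is needed here. [cite: Vihola2018, Appendix A (proof of Theorem 7)] -/
theorem memLp_sub_sumEstTrunc_of_bound (hR : Measurable R) (hΔm : ∀ k, Measurable (Δ k))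
    (hΔ2 : ∀ k, MemLp (Δ k) 2 μ) {m : ℕ} {B : ℝ} (hB0 : 0 ≤ B)
    (hfin : ∀ n, m ≤ n → ∫ ω, (sumEstTrunc Δ q R n ω - sumEstTrunc Δ q R m ω) ^ 2 ∂μ ≤ B) :
    MemLp (fun ω => sumEst Δ q R ω - sumEstTrunc Δ q R m ω) 2 μ ∧
      ∫ ω, (sumEst Δ q R ω - sumEstTrunc Δ q R m ω) ^ 2 ∂μ ≤ B := by
  have hZn : ∀ n, Measurable (sumEstTrunc Δ q R n) := fun n => measurable_sumEstTrunc hΔm hR n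
  have hZ : Measurable (sumEst Δ q R) := measurable_sumEst hΔm hR
  have hg : Measurable (fun ω => sumEst Δ q R ω - sumEstTrunc Δ q R m ω) := hZ.sub (hZn m)
  -- Fatou along `n → ∞`: at every `ω` the integrands are eventually constant
  have hlim : ∀ ω, Tendsto
      (fun n => ENNReal.ofReal ((sumEstTrunc Δ q R n ω - sumEstTrunc Δ q R m ω) ^ 2))
      atTop (𝓝 (ENNReal.ofReal ((sumEst Δ q R ω - sumEstTrunc Δ q R m ω) ^ 2))) := by
    intro ω
    refine tendsto_const_nhds.congr' ?_
    filter_upwards [eventually_gt_atTop (R ω)] with n hn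
    rw [sumEstTrunc_eq_sumEst_of_lt Δ q R hn]
  have hlint : ∫⁻ ω, ENNReal.ofReal ((sumEst Δ q R ω - sumEstTrunc Δ q R m ω) ^ 2) ∂μ ≤
      ENNReal.ofReal B := by
    calc ∫⁻ ω, ENNReal.ofReal ((sumEst Δ q R ω - sumEstTrunc Δ q R m ω) ^ 2) ∂μ
        = ∫⁻ ω, liminf (fun n => ENNReal.ofReal
            ((sumEstTrunc Δ q R n ω - sumEstTrunc Δ q R m ω) ^ 2)) atTop ∂μ :=
          lintegral_congr fun ω => ((hlim ω).liminf_eq).symm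
      _ ≤ liminf (fun n => ∫⁻ ω, ENNReal.ofReal
            ((sumEstTrunc Δ q R n ω - sumEstTrunc Δ q R m ω) ^ 2) ∂μ) atTop :=
          lintegral_liminf_le fun n => (((hZn n).sub (hZn m)).pow_const 2).ennreal_ofReal
      _ ≤ ENNReal.ofReal B := by
          refine liminf_le_of_frequently_le'
            (((eventually_ge_atTop m).mono fun n hmn => ?_).frequently)
          have hi : Integrable
              (fun ω => (sumEstTrunc Δ q R n ω - sumEstTrunc Δ q R m ω) ^ 2) μ :=
            ((memLp_sumEstTrunc hR hΔ2 n).sub (memLp_sumEstTrunc hR hΔ2 m)).integrable_sq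
          rw [← ofReal_integral_eq_lintegral_ofReal hi (ae_of_all _ fun ω => sq_nonneg _)]
          exact ENNReal.ofReal_le_ofReal (hfin n hmn)
  have hint : Integrable (fun ω => (sumEst Δ q R ω - sumEstTrunc Δ q R m ω) ^ 2) μ := by
    refine ⟨(hg.pow_const 2).aestronglyMeasurable, ?_⟩
    show ∫⁻ ω, ‖(sumEst Δ q R ω - sumEstTrunc Δ q R m ω) ^ 2‖ₑ ∂μ < ∞
    calc ∫⁻ ω, ‖(sumEst Δ q R ω - sumEstTrunc Δ q R m ω) ^ 2‖ₑ ∂μ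
        = ∫⁻ ω, ENNReal.ofReal ((sumEst Δ q R ω - sumEstTrunc Δ q R m ω) ^ 2) ∂μ :=
          lintegral_congr fun ω => Real.enorm_of_nonneg (sq_nonneg _)
      _ ≤ ENNReal.ofReal B := hlint
      _ < ∞ := ENNReal.ofReal_lt_top
  refine ⟨(memLp_two_iff_integrable_sq hg.aestronglyMeasurable).mpr hint, ?_⟩
  rw [← ENNReal.ofReal_le_ofReal_iff hB0,
    ofReal_integral_eq_lintegral_ofReal hint (ae_of_all _ fun ω => sq_nonneg _)]
  exact hlint

/-- **SECOND MOMENTS CONVERGE (generic)**: if `Z, Z_m ∈ L²` and `E(Z − Z_m)² → 0` then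
`E Z_m² → E Z²` (`|E Z_m² − E Z²| ≤ √(E(Z − Z_m)²) √(E(Z + Z_m)²)`, Cauchy–Schwarz).
[cite: Vihola2018, Appendix A (proof of Theorem 7: "`E Z² = lim E Z_{m_i}²`")] -/
theorem tendsto_integral_sq_of_tendsto {Z : Ω → ℝ} {Zm : ℕ → Ω → ℝ} (hZ2 : MemLp Z 2 μ)
    (hZm2 : ∀ m, MemLp (Zm m) 2 μ)
    (hd : Tendsto (fun m => ∫ ω, (Z ω - Zm m ω) ^ 2 ∂μ) atTop (𝓝 0)) :
    Tendsto (fun m => ∫ ω, Zm m ω ^ 2 ∂μ) atTop (𝓝 (∫ ω, Z ω ^ 2 ∂μ)) := by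
  set A : ℝ := ∫ ω, Z ω ^ 2 ∂μ with hA_def
  set d : ℕ → ℝ := fun m => ∫ ω, (Z ω - Zm m ω) ^ 2 ∂μ with hd_def
  have hD2 : ∀ m, MemLp (fun ω => Z ω - Zm m ω) 2 μ := fun m => hZ2.sub (hZm2 m)
  -- Cauchy–Schwarz `|E[fg]| ≤ √(E f²) √(E g²)` (Hölder, `p = q = 2`), kept local
  have hCS : ∀ {f g : Ω → ℝ}, MemLp f 2 μ → MemLp g 2 μ →
      |∫ ω, f ω * g ω ∂μ| ≤ Real.sqrt (∫ ω, f ω ^ 2 ∂μ) * Real.sqrt (∫ ω, g ω ^ 2 ∂μ) := by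
    intro f g hf hg
    have h2 : ENNReal.ofReal (2 : ℝ) = 2 := by norm_num
    have hf' : MemLp f (ENNReal.ofReal 2) μ := by rwa [h2]
    have hg' : MemLp g (ENNReal.ofReal 2) μ := by rwa [h2]
    have h := integral_mul_norm_le_Lp_mul_Lq Real.HolderConjugate.two_two hf' hg'
    simp only [Real.norm_eq_abs, Real.rpow_two, sq_abs] at h
    rw [Real.sqrt_eq_rpow, Real.sqrt_eq_rpow]
    calc |∫ ω, f ω * g ω ∂μ| ≤ ∫ ω, |f ω * g ω| ∂μ := abs_integral_le_integral_abs
      _ = ∫ ω, |f ω| * |g ω| ∂μ := by simp only [abs_mul]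
      _ ≤ (∫ ω, f ω ^ 2 ∂μ) ^ (1 / (2 : ℝ)) * (∫ ω, g ω ^ 2 ∂μ) ^ (1 / (2 : ℝ)) := h
  have hd0 : ∀ m, 0 ≤ d m := fun m => integral_nonneg fun ω => sq_nonneg _
  have hA0 : 0 ≤ A := integral_nonneg fun ω => sq_nonneg _
  -- `E(Z + Z_m)² ≤ 6 E Z² + 8 E(Z − Z_m)²`
  have hK : ∀ m, ∫ ω, (Z ω + Zm m ω) ^ 2 ∂μ ≤ 6 * A + 8 * d m := by
    intro m
    have hi1 : Integrable (fun ω => Z ω ^ 2) μ := hZ2.integrable_sq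
    have hi2 : Integrable (fun ω => (Z ω - Zm m ω) ^ 2) μ := (hD2 m).integrable_sq
    calc ∫ ω, (Z ω + Zm m ω) ^ 2 ∂μ
        ≤ ∫ ω, (6 * Z ω ^ 2 + 8 * (Z ω - Zm m ω) ^ 2) ∂μ := by
          refine integral_mono (hZ2.add (hZm2 m)).integrable_sq
            ((hi1.const_mul 6).add (hi2.const_mul 8)) (fun ω => ?_)
          nlinarith [sq_nonneg (Z ω - 3 * Zm m ω), sq_nonneg (Z ω - Zm m ω)]
      _ = 6 * A + 8 * d m := by
          rw [integral_add (hi1.const_mul 6) (hi2.const_mul 8), integral_const_mul,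
            integral_const_mul]
  have hkey : ∀ m, |∫ ω, Zm m ω ^ 2 ∂μ - A| ≤ Real.sqrt (d m) * Real.sqrt (6 * A + 8 * d m) := by
    intro m
    have e : ∫ ω, Zm m ω ^ 2 ∂μ - A = -∫ ω, (Z ω - Zm m ω) * (Z ω + Zm m ω) ∂μ := by
      rw [hA_def, ← integral_sub (hZm2 m).integrable_sq hZ2.integrable_sq, ← integral_neg]
      refine integral_congr_ae (ae_of_all _ fun ω => ?_)
      simp only
      ring
    rw [e, abs_neg]
    calc |∫ ω, (Z ω - Zm m ω) * (Z ω + Zm m ω) ∂μ|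
        ≤ Real.sqrt (d m) * Real.sqrt (∫ ω, (Z ω + Zm m ω) ^ 2 ∂μ) :=
          hCS (hD2 m) (hZ2.add (hZm2 m))
      _ ≤ Real.sqrt (d m) * Real.sqrt (6 * A + 8 * d m) := by
          gcongr
          exact hK m
  have hbound : Tendsto (fun m => Real.sqrt (d m) * Real.sqrt (6 * A + 8 * d m)) atTop (𝓝 0) := by
    have h1 : Tendsto (fun m => Real.sqrt (d m)) atTop (𝓝 0) := by
      simpa using hd.sqrt
    have h2 : Tendsto (fun m => Real.sqrt (6 * A + 8 * d m)) atTop (𝓝 (Real.sqrt (6 * A))) := by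
      have := ((hd.const_mul 8).const_add (6 * A)).sqrt
      simpa using this
    simpa using h1.mul h2
  rw [← tendsto_sub_nhds_zero_iff]
  exact squeeze_zero_norm (fun m => by rw [Real.norm_eq_abs]; exact hkey m) hbound

/-- **MEANS CONVERGE (generic)**, on a probability space: if `Z, Z_m ∈ L²`, `E(Z − Z_m)² → 0`, and
`E Z_m = c_m → L`, then `E Z = L` (Vihola: "`E Z = lim E Z_{m_i} = lim E Y_{m_i} = E Y`").
[cite: Vihola2018, Appendix A (proof of Theorem 7)] -/
theorem integral_eq_of_tendsto [IsProbabilityMeasure μ] {Z : Ω → ℝ} {Zm : ℕ → Ω → ℝ}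
    (hZ2 : MemLp Z 2 μ) (hZm2 : ∀ m, MemLp (Zm m) 2 μ)
    (hd : Tendsto (fun m => ∫ ω, (Z ω - Zm m ω) ^ 2 ∂μ) atTop (𝓝 0)) {c : ℕ → ℝ} {L : ℝ}
    (hmean : ∀ m, ∫ ω, Zm m ω ∂μ = c m) (hc : Tendsto c atTop (𝓝 L)) :
    ∫ ω, Z ω ∂μ = L := by
  -- `|E f| ≤ E|f| ≤ √(E f²)` on a probability space (`sq_integral_abs_le`)
  have hL1 : ∀ {f : Ω → ℝ}, MemLp f 2 μ → |∫ ω, f ω ∂μ| ≤ Real.sqrt (∫ ω, f ω ^ 2 ∂μ) := by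
    intro f hf
    have h1 := Real.abs_le_sqrt (sq_integral_abs_le hf)
    rw [abs_of_nonneg (integral_nonneg fun ω => abs_nonneg _)] at h1
    exact abs_integral_le_integral_abs.trans h1
  have hkey : ∀ m, |∫ ω, Z ω ∂μ - L| ≤
      Real.sqrt (∫ ω, (Z ω - Zm m ω) ^ 2 ∂μ) + |c m - L| := by
    intro m
    have e : ∫ ω, Z ω ∂μ - L = ∫ ω, (Z ω - Zm m ω) ∂μ + (c m - L) := by
      rw [integral_sub (hZ2.integrable one_le_two) ((hZm2 m).integrable one_le_two), hmean m]
      ring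
    rw [e]
    have h1 : |∫ ω, (Z ω - Zm m ω) ∂μ| ≤ Real.sqrt (∫ ω, (Z ω - Zm m ω) ^ 2 ∂μ) :=
      hL1 (hZ2.sub (hZm2 m))
    calc |∫ ω, (Z ω - Zm m ω) ∂μ + (c m - L)|
        ≤ |∫ ω, (Z ω - Zm m ω) ∂μ| + |c m - L| := abs_add_le _ _
      _ ≤ Real.sqrt (∫ ω, (Z ω - Zm m ω) ^ 2 ∂μ) + |c m - L| := by linarith
  have hlim : Tendsto (fun m => Real.sqrt (∫ ω, (Z ω - Zm m ω) ^ 2 ∂μ) + |c m - L|) atTop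
      (𝓝 0) := by
    have h2 : Tendsto (fun m => |c m - L|) atTop (𝓝 0) := by
      have := (tendsto_sub_nhds_zero_iff.mpr hc).abs
      simpa using this
    simpa using hd.sqrt.add h2
  have h0 : |∫ ω, Z ω ∂μ - L| ≤ 0 := le_of_tendsto_of_tendsto' tendsto_const_nhds hlim hkey
  have := abs_nonneg (∫ ω, Z ω ∂μ - L)
  linarith [abs_eq_zero.mp (le_antisymm h0 this)]

/-- **THE COUPLED SUM IS THE `L²` LIMIT OF ITS TRUNCATIONS** (Vihola, proof of Theorem 7:
"`(Z_{m_i})` is Cauchy in `L²` … `Z_{m_i} → Z` a.s., and therefore `Z_{m_i} → Z` in `L²`";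
Rhee–Glynn's Theorem 1): under the coupled-sum condition `Σ_i E(Y_i − S)²/q_i < ∞` (printed
`Σ_{i≥1} E(Y_{i−1} − Y)²/p̃_i < ∞`), for every `m`, `Z_Σ − Z_m ∈ L²` and
`E(Z_Σ − Z_m)² ≤ 4 Σ_{i≥m} E(Y_i − S)²/q_i`.
[cite: Vihola2018, Appendix A (proof of Theorem 7) and §4 Example 10]; [cite: RheeGlynn2015,
Theorem 1] -/
theorem memLp_sub_sumEstTrunc [IsFiniteMeasure μ] (hR : Measurable R)
    (hΔm : ∀ k, Measurable (Δ k)) (hΔ2 : ∀ k, MemLp (Δ k) 2 μ)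
    (hind2 : ∀ i k, IndepFun R (fun ω => Δ i ω * Δ k ω) μ)
    (hq : ∀ k, μ.real {ω | k ≤ R ω} = q k) (hq0 : ∀ k, 0 < q k) {S : Ω → ℝ} (hS : MemLp S 2 μ)
    (hc : Summable fun i => (∫ ω, (partialSum Δ i ω - S ω) ^ 2 ∂μ) / q i) (m : ℕ) :
    MemLp (fun ω => sumEst Δ q R ω - sumEstTrunc Δ q R m ω) 2 μ ∧
      ∫ ω, (sumEst Δ q R ω - sumEstTrunc Δ q R m ω) ^ 2 ∂μ ≤
        4 * ∑' i, (∫ ω, (partialSum Δ (i + m) ω - S ω) ^ 2 ∂μ) / q (i + m) := by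
  set c : ℕ → ℝ := fun i => (∫ ω, (partialSum Δ i ω - S ω) ^ 2 ∂μ) / q i with hc_def
  have hc0 : ∀ i, 0 ≤ c i :=
    fun i => div_nonneg (integral_nonneg fun ω => sq_nonneg _) (hq0 i).le
  have hcs : Summable (fun i => c (i + m)) := (summable_nat_add_iff m).mpr hc
  have hτ0 : 0 ≤ ∑' i, c (i + m) := tsum_nonneg fun i => hc0 _
  refine memLp_sub_sumEstTrunc_of_bound hR hΔm hΔ2 (by positivity) (fun n hmn => ?_)
  refine (integral_sub_sumEstTrunc_sq_le hR hΔm hΔ2 hind2 hq hq0 hS hmn).trans ?_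
  refine mul_le_mul_of_nonneg_left ?_ (by norm_num)
  show ∑ i ∈ Ico m (n + 1), c i ≤ ∑' i, c (i + m)
  rw [sum_Ico_eq_sum_range]
  have e : ∀ k, c (m + k) = c (k + m) := fun k => by rw [add_comm]
  simp only [e]
  exact hcs.sum_le_tsum (range (n + 1 - m)) (fun k _ => hc0 _)

/-- **RHEE–GLYNN 2015, THEOREM 1 / VIHOLA 2018, THEOREM 5 (coupled sum) — square integrability**:
under `Σ_i E(Y_i − S)²/q_i < ∞` the coupled-sum estimator `Z_Σ` is in `L²`, with
`E Z_Σ² ≤ 4 Σ_i E(Y_i − S)²/q_i`. [cite: RheeGlynn2015, Theorem 1]; [cite: Vihola2018, §3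
Theorem 5 with Condition 4 (i)] -/
theorem memLp_sumEst [IsFiniteMeasure μ] (hR : Measurable R)
    (hΔm : ∀ k, Measurable (Δ k)) (hΔ2 : ∀ k, MemLp (Δ k) 2 μ)
    (hind2 : ∀ i k, IndepFun R (fun ω => Δ i ω * Δ k ω) μ)
    (hq : ∀ k, μ.real {ω | k ≤ R ω} = q k) (hq0 : ∀ k, 0 < q k) {S : Ω → ℝ} (hS : MemLp S 2 μ)
    (hc : Summable fun i => (∫ ω, (partialSum Δ i ω - S ω) ^ 2 ∂μ) / q i) :
    MemLp (sumEst Δ q R) 2 μ ∧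
      ∫ ω, sumEst Δ q R ω ^ 2 ∂μ ≤ 4 * ∑' i, (∫ ω, (partialSum Δ i ω - S ω) ^ 2 ∂μ) / q i := by
  have h := memLp_sub_sumEstTrunc hR hΔm hΔ2 hind2 hq hq0 hS hc 0
  simpa [sumEstTrunc] using h

/-- `E(Z_Σ − Z_m)² → 0`: the truncations converge to the coupled sum in `L²`.
[cite: Vihola2018, Appendix A (proof of Theorem 7)] -/
theorem tendsto_integral_sub_sumEstTrunc_sq [IsFiniteMeasure μ] (hR : Measurable R)
    (hΔm : ∀ k, Measurable (Δ k)) (hΔ2 : ∀ k, MemLp (Δ k) 2 μ)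
    (hind2 : ∀ i k, IndepFun R (fun ω => Δ i ω * Δ k ω) μ)
    (hq : ∀ k, μ.real {ω | k ≤ R ω} = q k) (hq0 : ∀ k, 0 < q k) {S : Ω → ℝ} (hS : MemLp S 2 μ)
    (hc : Summable fun i => (∫ ω, (partialSum Δ i ω - S ω) ^ 2 ∂μ) / q i) :
    Tendsto (fun m => ∫ ω, (sumEst Δ q R ω - sumEstTrunc Δ q R m ω) ^ 2 ∂μ) atTop (𝓝 0) := by
  have hτ : Tendsto (fun m => 4 * ∑' i, (∫ ω, (partialSum Δ (i + m) ω - S ω) ^ 2 ∂μ) / q (i + m))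
      atTop (𝓝 0) := by
    have h := (tendsto_sum_nat_add fun i => (∫ ω, (partialSum Δ i ω - S ω) ^ 2 ∂μ) / q i).const_mul
      (4 : ℝ)
    simpa using h
  refine squeeze_zero (fun m => integral_nonneg fun ω => sq_nonneg _)
    (fun m => (memLp_sub_sumEstTrunc hR hΔm hΔ2 hind2 hq hq0 hS hc m).2) hτ

/-- **SECOND MOMENTS CONVERGE**: `E Z_m² → E Z_Σ²` (Vihola: "`E Z² = lim_i E Z_{m_i}²`").
[cite: Vihola2018, Appendix A (proof of Theorem 7, last sentence)] -/
theorem tendsto_integral_sumEstTrunc_sq [IsFiniteMeasure μ] (hR : Measurable R)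
    (hΔm : ∀ k, Measurable (Δ k)) (hΔ2 : ∀ k, MemLp (Δ k) 2 μ)
    (hind2 : ∀ i k, IndepFun R (fun ω => Δ i ω * Δ k ω) μ)
    (hq : ∀ k, μ.real {ω | k ≤ R ω} = q k) (hq0 : ∀ k, 0 < q k) {S : Ω → ℝ} (hS : MemLp S 2 μ)
    (hc : Summable fun i => (∫ ω, (partialSum Δ i ω - S ω) ^ 2 ∂μ) / q i) :
    Tendsto (fun m => ∫ ω, sumEstTrunc Δ q R m ω ^ 2 ∂μ) atTop
      (𝓝 (∫ ω, sumEst Δ q R ω ^ 2 ∂μ)) :=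
  tendsto_integral_sq_of_tendsto (memLp_sumEst hR hΔm hΔ2 hind2 hq hq0 hS hc).1
    (memLp_sumEstTrunc hR hΔ2) (tendsto_integral_sub_sumEstTrunc_sq hR hΔm hΔ2 hind2 hq hq0 hS hc)

/-- **RHEE–GLYNN 2015, THEOREM 1 / VIHOLA 2018, THEOREM 5 — UNBIASEDNESS of the coupled sum**:
under the coupled-sum condition (and `R` independent of each increment), `E Z_Σ = E S` whenever
`S` is the `L²` limit of the approximations in the printed sense `Σ_i E(Y_i − S)²/q_i < ∞`
(Vihola: "`E Z = lim E Z_{m_i} = lim E Y_{m_i} = E Y`"). [cite: RheeGlynn2015, Theorem 1];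
[cite: Vihola2018, §3 Theorem 5 (first claim) and Appendix A] -/
theorem integral_sumEst_eq [IsProbabilityMeasure μ] (hR : Measurable R)
    (hΔm : ∀ k, Measurable (Δ k)) (hΔ2 : ∀ k, MemLp (Δ k) 2 μ) (hind : ∀ k, IndepFun R (Δ k) μ)
    (hind2 : ∀ i k, IndepFun R (fun ω => Δ i ω * Δ k ω) μ)
    (hq : ∀ k, μ.real {ω | k ≤ R ω} = q k) (hq0 : ∀ k, 0 < q k) {S : Ω → ℝ} (hS : MemLp S 2 μ)
    (hc : Summable fun i => (∫ ω, (partialSum Δ i ω - S ω) ^ 2 ∂μ) / q i) :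
    ∫ ω, sumEst Δ q R ω ∂μ = ∫ ω, S ω ∂μ := by
  set a : ℕ → ℝ := fun i => ∫ ω, (partialSum Δ i ω - S ω) ^ 2 ∂μ with ha_def
  -- `|E f| ≤ E|f| ≤ √(E f²)` on a probability space (`sq_integral_abs_le`)
  have hL1 : ∀ {f : Ω → ℝ}, MemLp f 2 μ → |∫ ω, f ω ∂μ| ≤ Real.sqrt (∫ ω, f ω ^ 2 ∂μ) := by
    intro f hf
    have h1 := Real.abs_le_sqrt (sq_integral_abs_le hf)
    rw [abs_of_nonneg (integral_nonneg fun ω => abs_nonneg _)] at h1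
    exact abs_integral_le_integral_abs.trans h1
  have hY2 : ∀ i, MemLp (partialSum Δ i) 2 μ := by
    intro i
    unfold partialSum
    exact memLp_finsetSum (range i) (fun k _ => hΔ2 k)
  -- `a_m = (a_m/q_m) q_m ≤ a_m/q_m → 0`
  have hq1 : ∀ k, q k ≤ 1 := fun k => by rw [← hq k]; exact measureReal_le_one
  have ha0 : ∀ i, 0 ≤ a i := fun i => integral_nonneg fun ω => sq_nonneg _
  have ha : Tendsto a atTop (𝓝 0) := by
    refine squeeze_zero ha0 (fun m => ?_) hc.tendsto_atTop_zero
    calc a m = a m / q m * q m := by field_simp [(hq0 m).ne']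
      _ ≤ a m / q m * 1 := mul_le_mul_of_nonneg_left (hq1 m) (div_nonneg (ha0 m) (hq0 m).le)
      _ = a m / q m := mul_one _
  -- `E Y_m → E S`
  have hmeanY : Tendsto (fun m => ∫ ω, partialSum Δ m ω ∂μ) atTop (𝓝 (∫ ω, S ω ∂μ)) := by
    rw [← tendsto_sub_nhds_zero_iff]
    refine squeeze_zero_norm (fun m => ?_) (by simpa using ha.sqrt)
    rw [Real.norm_eq_abs, ← integral_sub ((hY2 m).integrable one_le_two) (hS.integrable one_le_two)]
    exact hL1 ((hY2 m).sub hS)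
  exact integral_eq_of_tendsto (memLp_sumEst hR hΔm hΔ2 hind2 hq hq0 hS hc).1
    (memLp_sumEstTrunc hR hΔ2) (tendsto_integral_sub_sumEstTrunc_sq hR hΔm hΔ2 hind2 hq hq0 hS hc)
    (fun m => integral_sumEstTrunc hR hΔm (fun k => (hΔ2 k).integrable one_le_two) hind hq hq0 m)
    hmeanY

/-! ### Summation by parts and the limit of the finite-level second moments -/

/-- The ABEL WEIGHTS of the survival probabilities: `w_0 = 1/q_0`, `w_{i+1} = 1/q_{i+1} − 1/q_i`
(so that `1/q_i = Σ_{l≤i} w_l`); summation by parts turns the telescoped second moment into a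
non-negative combination `Σ_i E(Y_i − Y_m)² w_i`, to which "dominated convergence" (Vihola) applies.
[cite: Vihola2018, §4 Example 10 ("The variance satisfies by dominated convergence …")] -/
def abelWeight (q : ℕ → ℝ) : ℕ → ℝ
  | 0 => 1 / q 0
  | i + 1 => 1 / q (i + 1) - 1 / q i

/-- [cite: Vihola2018, §4 Example 10] -/
@[simp] theorem abelWeight_zero (q : ℕ → ℝ) : abelWeight q 0 = 1 / q 0 := rfl

/-- [cite: Vihola2018, §4 Example 10] -/
@[simp] theorem abelWeight_succ (q : ℕ → ℝ) (i : ℕ) :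
    abelWeight q (i + 1) = 1 / q (i + 1) - 1 / q i := rfl

/-- `Σ_{i≤m} w_i = 1/q_m`. [cite: Vihola2018, §4 Example 10] -/
theorem sum_abelWeight (q : ℕ → ℝ) (m : ℕ) : ∑ i ∈ range (m + 1), abelWeight q i = 1 / q m := by
  induction m with
  | zero => simp
  | succ m ih => rw [sum_range_succ, ih, abelWeight_succ]; ring

/-- `w_i ≥ 0` for non-increasing positive `q`. [cite: Vihola2018, §4 Example 10] -/
theorem abelWeight_nonneg (hq0 : ∀ k, 0 < q k) (hqa : Antitone q) (i : ℕ) :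
    0 ≤ abelWeight q i := by
  cases i with
  | zero => rw [abelWeight_zero]; exact (one_div_pos.mpr (hq0 0)).le
  | succ i =>
    rw [abelWeight_succ]
    exact sub_nonneg.mpr (one_div_le_one_div_of_le (hq0 _) (hqa (Nat.le_succ i)))

/-- `w_i ≤ 1/q_i`. [cite: Vihola2018, §4 Example 10] -/
theorem abelWeight_le (hq0 : ∀ k, 0 < q k) (i : ℕ) : abelWeight q i ≤ 1 / q i := by
  cases i with
  | zero => rw [abelWeight_zero]
  | succ i => rw [abelWeight_succ]; exact sub_le_self _ (one_div_pos.mpr (hq0 i)).le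

/-- `Σ_{i<m} w_i ≤ 1/q_m`. [cite: Vihola2018, §4 Example 10] -/
theorem sum_abelWeight_le (hq0 : ∀ k, 0 < q k) (hqa : Antitone q) (m : ℕ) :
    ∑ i ∈ range m, abelWeight q i ≤ 1 / q m := by
  cases m with
  | zero => rw [sum_range_zero]; exact (one_div_pos.mpr (hq0 0)).le
  | succ k =>
    rw [sum_abelWeight]
    exact one_div_le_one_div_of_le (hq0 _) (hqa (Nat.le_succ k))

/-- Summation by parts from level `0`: `Σ_{i≤m} (b_i − b_{i+1})/q_i = Σ_{i≤m} b_i w_i − b_{m+1}/q_m`.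
[cite: Vihola2018, §4 Example 10] -/
theorem sum_range_sub_div (b q : ℕ → ℝ) (m : ℕ) :
    ∑ i ∈ range (m + 1), (b i - b (i + 1)) / q i =
      ∑ i ∈ range (m + 1), b i * abelWeight q i - b (m + 1) / q m := by
  induction m with
  | zero =>
    simp only [zero_add, sum_range_one, abelWeight_zero]
    ring
  | succ m ih =>
    rw [sum_range_succ, ih, sum_range_succ _ (m + 1), abelWeight_succ]
    ring

/-- The `m`-level second moment after summation by parts:
`E Z_m² = Σ_{i<m} E(Y_i − Y_m)² w_i` (a non-negative combination).
[cite: Vihola2018, §4 Example 10] -/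
theorem integral_sumEstTrunc_sq_abel (hR : Measurable R) (hΔm : ∀ k, Measurable (Δ k))
    (hΔ2 : ∀ k, MemLp (Δ k) 2 μ) (hind2 : ∀ i k, IndepFun R (fun ω => Δ i ω * Δ k ω) μ)
    (hq : ∀ k, μ.real {ω | k ≤ R ω} = q k) (hq0 : ∀ k, 0 < q k) (m : ℕ) :
    ∫ ω, sumEstTrunc Δ q R m ω ^ 2 ∂μ =
      ∑ i ∈ range m, (∫ ω, (partialSum Δ i ω - partialSum Δ m ω) ^ 2 ∂μ) * abelWeight q i := by
  rw [integral_sumEstTrunc_sq_telescope hR hΔm hΔ2 hind2 hq hq0 m]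
  cases m with
  | zero => simp
  | succ k =>
    have h := sum_range_sub_div
      (fun i => ∫ ω, (partialSum Δ i ω - partialSum Δ (k + 1) ω) ^ 2 ∂μ) q k
    beta_reduce at h
    rw [h]
    simp

/-- Cauchy–Schwarz for a finite non-negative weighted sum: `Σ w_i x_i ≤ √(Σ w_i) √(Σ w_i x_i²)`.
[cite: Vihola2018, §4 Example 10 ("by dominated convergence")] -/
theorem sum_mul_le_sqrt_mul_sqrt {s : Finset ℕ} {w x : ℕ → ℝ} (hw : ∀ i ∈ s, 0 ≤ w i) :
    ∑ i ∈ s, w i * x i ≤ Real.sqrt (∑ i ∈ s, w i) * Real.sqrt (∑ i ∈ s, w i * x i ^ 2) := by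
  have h := sum_mul_sq_le_sq_mul_sq s (fun i => Real.sqrt (w i)) (fun i => Real.sqrt (w i) * x i)
  have e1 : ∀ i ∈ s, Real.sqrt (w i) * (Real.sqrt (w i) * x i) = w i * x i := fun i hi => by
    rw [← mul_assoc, Real.mul_self_sqrt (hw i hi)]
  have e2 : ∀ i ∈ s, Real.sqrt (w i) ^ 2 = w i := fun i hi => Real.sq_sqrt (hw i hi)
  have e3 : ∀ i ∈ s, (Real.sqrt (w i) * x i) ^ 2 = w i * x i ^ 2 := fun i hi => by
    rw [mul_pow, Real.sq_sqrt (hw i hi)]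
  rw [sum_congr rfl e1, sum_congr rfl e2, sum_congr rfl e3] at h
  rw [← Real.sqrt_mul (sum_nonneg hw)]
  exact (le_abs_self _).trans (Real.abs_le_sqrt h)

/-- Summability of the Abel-weighted series: `0 ≤ E(Y_i − S)² w_i ≤ E(Y_i − S)²/q_i`.
[cite: Vihola2018, §4 Example 10] -/
theorem summable_mul_abelWeight (hq0 : ∀ k, 0 < q k) (hqa : Antitone q) {a : ℕ → ℝ}
    (ha0 : ∀ i, 0 ≤ a i) (hc : Summable fun i => a i / q i) :
    Summable fun i => a i * abelWeight q i :=
  Summable.of_nonneg_of_le (fun i => mul_nonneg (ha0 i) (abelWeight_nonneg hq0 hqa i))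
    (fun i => (mul_le_mul_of_nonneg_left (abelWeight_le hq0 i) (ha0 i)).trans_eq
      (mul_one_div _ _)) hc

/-- **THE LIMIT OF THE ABEL-SUMMED SECOND MOMENTS, as a statement about real sequences** (Vihola's
"by dominated convergence"): if `q > 0` is non-increasing, `a ≥ 0` with `Σ_i a_i/q_i < ∞`, and the
level-`m` quantities satisfy `|b^m_i − a_i| ≤ √(a_m) √(6a_i + 4a_m)`, then
`Σ_{i<m} b^m_i w_i → Σ_i a_i w_i`; the error is at most `√(c_m) √(6T + 4c_m)`, `c_m = a_m/q_m → 0`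
(Cauchy–Schwarz for the weighted finite sum). [cite: Vihola2018, §4 Example 10] -/
theorem tendsto_sum_mul_abelWeight_of_abs_sub_le {a : ℕ → ℝ} {b : ℕ → ℕ → ℝ}
    (hq0 : ∀ k, 0 < q k) (hqa : Antitone q) (ha0 : ∀ i, 0 ≤ a i)
    (hc : Summable fun i => a i / q i)
    (hba : ∀ m i, |b m i - a i| ≤ Real.sqrt (a m) * Real.sqrt (6 * a i + 4 * a m)) :
    Tendsto (fun m => ∑ i ∈ range m, b m i * abelWeight q i) atTop
      (𝓝 (∑' i, a i * abelWeight q i)) := by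
  set w : ℕ → ℝ := abelWeight q with hw_def
  set c : ℕ → ℝ := fun i => a i / q i with hc_def
  have hw0 : ∀ i, 0 ≤ w i := abelWeight_nonneg hq0 hqa
  have hc0 : ∀ i, 0 ≤ c i := fun i => div_nonneg (ha0 i) (hq0 i).le
  have haw : Summable (fun i => a i * w i) := summable_mul_abelWeight hq0 hqa ha0 hc
  set T : ℝ := ∑' i, a i * w i with hT_def
  have hT0 : 0 ≤ T := tsum_nonneg fun i => mul_nonneg (ha0 i) (hw0 i)
  have hTle : ∀ m, ∑ i ∈ range m, a i * w i ≤ T :=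
    fun m => haw.sum_le_tsum _ (fun i _ => mul_nonneg (ha0 i) (hw0 i))
  have hβ : Tendsto (fun m => ∑ i ∈ range m, a i * w i) atTop (𝓝 T) := haw.hasSum.tendsto_sum_nat
  -- the error of level `m`
  have hγ : ∀ m, |∑ i ∈ range m, b m i * w i - ∑ i ∈ range m, a i * w i| ≤
      Real.sqrt (c m) * Real.sqrt (6 * T + 4 * c m) := by
    intro m
    have hsw : ∑ i ∈ range m, w i ≤ 1 / q m := sum_abelWeight_le hq0 hqa m
    rw [← sum_sub_distrib]
    calc |∑ i ∈ range m, (b m i * w i - a i * w i)|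
        ≤ ∑ i ∈ range m, |b m i * w i - a i * w i| := abs_sum_le_sum_abs _ _
      _ = ∑ i ∈ range m, w i * |b m i - a i| :=
          sum_congr rfl fun i _ => by rw [← sub_mul, abs_mul, abs_of_nonneg (hw0 i), mul_comm]
      _ ≤ ∑ i ∈ range m, w i * (Real.sqrt (a m) * Real.sqrt (6 * a i + 4 * a m)) :=
          sum_le_sum fun i _ => mul_le_mul_of_nonneg_left (hba m i) (hw0 i)
      _ = Real.sqrt (a m) * ∑ i ∈ range m, w i * Real.sqrt (6 * a i + 4 * a m) := by
          rw [mul_sum]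
          exact sum_congr rfl fun i _ => by ring
      _ ≤ Real.sqrt (a m) * (Real.sqrt (∑ i ∈ range m, w i) *
            Real.sqrt (∑ i ∈ range m, w i * Real.sqrt (6 * a i + 4 * a m) ^ 2)) :=
          mul_le_mul_of_nonneg_left (sum_mul_le_sqrt_mul_sqrt fun i _ => hw0 i)
            (Real.sqrt_nonneg _)
      _ = Real.sqrt (a m) * (Real.sqrt (∑ i ∈ range m, w i) *
            Real.sqrt (6 * ∑ i ∈ range m, a i * w i + 4 * a m * ∑ i ∈ range m, w i)) := by
          congr 3
          rw [mul_sum, mul_sum, ← sum_add_distrib]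
          refine sum_congr rfl fun i _ => ?_
          rw [Real.sq_sqrt (by nlinarith [ha0 i, ha0 m])]
          ring
      _ ≤ Real.sqrt (a m) * (Real.sqrt (1 / q m) * Real.sqrt (6 * T + 4 * a m * (1 / q m))) := by
          have h4 : 0 ≤ 4 * a m := mul_nonneg (by norm_num) (ha0 m)
          gcongr
          · exact hTle m
      _ = Real.sqrt (c m) * Real.sqrt (6 * T + 4 * c m) := by
          have e3 : Real.sqrt (a m) * Real.sqrt (1 / q m) = Real.sqrt (c m) := by
            show Real.sqrt (a m) * Real.sqrt (1 / q m) = Real.sqrt (a m / q m)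
            rw [← Real.sqrt_mul (ha0 m), mul_one_div]
          have e4 : 4 * a m * (1 / q m) = 4 * c m := by
            show 4 * a m * (1 / q m) = 4 * (a m / q m)
            ring
          rw [← mul_assoc, e3, e4]
  -- assemble
  have hcm : Tendsto c atTop (𝓝 0) := hc.tendsto_atTop_zero
  have hε : Tendsto (fun m => Real.sqrt (c m) * Real.sqrt (6 * T + 4 * c m)) atTop (𝓝 0) := by
    have h := hcm.sqrt.mul ((hcm.const_mul 4).const_add (6 * T)).sqrt
    simpa using h
  have hdiff : Tendsto (fun m => ∑ i ∈ range m, b m i * w i - ∑ i ∈ range m, a i * w i)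
      atTop (𝓝 0) :=
    squeeze_zero_norm (fun m => by rw [Real.norm_eq_abs]; exact hγ m) hε
  have h := hβ.add hdiff
  simp only [add_zero, add_sub_cancel] at h
  exact h

/-- **THE LIMIT OF THE FINITE-LEVEL SECOND MOMENTS** (Vihola's "by dominated convergence"):
under `Σ_i E(Y_i − S)²/q_i < ∞`, `Σ_{i<m} E(Y_i − Y_m)² w_i → Σ_i E(Y_i − S)² w_i`, because
`|E(Y_i − Y_m)² − E(Y_i − S)²| ≤ √(E(Y_m − S)²) √(6E(Y_i − S)² + 4E(Y_m − S)²)` (Cauchy–Schwarz).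
[cite: Vihola2018, §4 Example 10] -/
theorem tendsto_sum_mul_abelWeight [IsFiniteMeasure μ] (hΔ2 : ∀ k, MemLp (Δ k) 2 μ)
    (hq0 : ∀ k, 0 < q k) (hqa : Antitone q) {S : Ω → ℝ} (hS : MemLp S 2 μ)
    (hc : Summable fun i => (∫ ω, (partialSum Δ i ω - S ω) ^ 2 ∂μ) / q i) :
    Tendsto (fun m => ∑ i ∈ range m,
        (∫ ω, (partialSum Δ i ω - partialSum Δ m ω) ^ 2 ∂μ) * abelWeight q i) atTop
      (𝓝 (∑' i, (∫ ω, (partialSum Δ i ω - S ω) ^ 2 ∂μ) * abelWeight q i)) := by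
  set a : ℕ → ℝ := fun i => ∫ ω, (partialSum Δ i ω - S ω) ^ 2 ∂μ with ha_def
  have hY2 : ∀ i, MemLp (partialSum Δ i) 2 μ := by
    intro i
    unfold partialSum
    exact memLp_finsetSum (range i) (fun k _ => hΔ2 k)
  have ha0 : ∀ i, 0 ≤ a i := fun i => integral_nonneg fun ω => sq_nonneg _
  -- Cauchy–Schwarz `|E[fg]| ≤ √(E f²) √(E g²)` (Hölder, `p = q = 2`), kept local
  have hCS : ∀ {f g : Ω → ℝ}, MemLp f 2 μ → MemLp g 2 μ →
      |∫ ω, f ω * g ω ∂μ| ≤ Real.sqrt (∫ ω, f ω ^ 2 ∂μ) * Real.sqrt (∫ ω, g ω ^ 2 ∂μ) := by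
    intro f g hf hg
    have h2 : ENNReal.ofReal (2 : ℝ) = 2 := by norm_num
    have hf' : MemLp f (ENNReal.ofReal 2) μ := by rwa [h2]
    have hg' : MemLp g (ENNReal.ofReal 2) μ := by rwa [h2]
    have h := integral_mul_norm_le_Lp_mul_Lq Real.HolderConjugate.two_two hf' hg'
    simp only [Real.norm_eq_abs, Real.rpow_two, sq_abs] at h
    rw [Real.sqrt_eq_rpow, Real.sqrt_eq_rpow]
    calc |∫ ω, f ω * g ω ∂μ| ≤ ∫ ω, |f ω * g ω| ∂μ := abs_integral_le_integral_abs
      _ = ∫ ω, |f ω| * |g ω| ∂μ := by simp only [abs_mul]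
      _ ≤ (∫ ω, f ω ^ 2 ∂μ) ^ (1 / (2 : ℝ)) * (∫ ω, g ω ^ 2 ∂μ) ^ (1 / (2 : ℝ)) := h
  refine tendsto_sum_mul_abelWeight_of_abs_sub_le
    (b := fun m i => ∫ ω, (partialSum Δ i ω - partialSum Δ m ω) ^ 2 ∂μ) hq0 hqa ha0 hc ?_
  -- `|E(Y_i − Y_m)² − E(Y_i − S)²| ≤ √(a_m) √(6 a_i + 4 a_m)`
  intro m i
  have hF : MemLp (fun ω => S ω - partialSum Δ m ω) 2 μ := hS.sub (hY2 m)
  have hG : MemLp (fun ω => (partialSum Δ i ω - partialSum Δ m ω) +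
      (partialSum Δ i ω - S ω)) 2 μ := ((hY2 i).sub (hY2 m)).add ((hY2 i).sub hS)
  have hiA : Integrable (fun ω => (partialSum Δ i ω - S ω) ^ 2) μ :=
    ((hY2 i).sub hS).integrable_sq
  have hiB : Integrable (fun ω => (partialSum Δ m ω - S ω) ^ 2) μ :=
    ((hY2 m).sub hS).integrable_sq
  have hiC : Integrable (fun ω => (partialSum Δ i ω - partialSum Δ m ω) ^ 2) μ :=
    ((hY2 i).sub (hY2 m)).integrable_sq
  have e : (∫ ω, (partialSum Δ i ω - partialSum Δ m ω) ^ 2 ∂μ) - a i =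
      ∫ ω, (S ω - partialSum Δ m ω) *
        ((partialSum Δ i ω - partialSum Δ m ω) + (partialSum Δ i ω - S ω)) ∂μ := by
    show (∫ ω, (partialSum Δ i ω - partialSum Δ m ω) ^ 2 ∂μ) -
        ∫ ω, (partialSum Δ i ω - S ω) ^ 2 ∂μ = _
    rw [← integral_sub hiC hiA]
    refine integral_congr_ae (ae_of_all _ fun ω => ?_)
    simp only
    ring
  have e1 : ∫ ω, (S ω - partialSum Δ m ω) ^ 2 ∂μ = a m := by
    refine integral_congr_ae (ae_of_all _ fun ω => ?_)
    simp only
    ring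
  have e2 : ∫ ω, ((partialSum Δ i ω - partialSum Δ m ω) + (partialSum Δ i ω - S ω)) ^ 2 ∂μ ≤
      6 * a i + 4 * a m := by
    calc ∫ ω, ((partialSum Δ i ω - partialSum Δ m ω) + (partialSum Δ i ω - S ω)) ^ 2 ∂μ
        ≤ ∫ ω, (6 * (partialSum Δ i ω - S ω) ^ 2 + 4 * (partialSum Δ m ω - S ω) ^ 2) ∂μ := by
          refine integral_mono hG.integrable_sq ((hiA.const_mul 6).add (hiB.const_mul 4))
            (fun ω => ?_)
          nlinarith [sq_nonneg ((partialSum Δ i ω - S ω) + (partialSum Δ m ω - S ω)),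
            sq_nonneg (partialSum Δ m ω - S ω)]
      _ = 6 * a i + 4 * a m := by
          rw [integral_add (hiA.const_mul 6) (hiB.const_mul 4), integral_const_mul,
            integral_const_mul]
  show |(∫ ω, (partialSum Δ i ω - partialSum Δ m ω) ^ 2 ∂μ) - a i| ≤ _
  rw [e]
  refine (hCS hF hG).trans ?_
  rw [e1]
  gcongr

/-- **THE PRINTED SERIES EQUALS THE ABEL-SUMMED ONE** (real sequences): for `q > 0` non-increasing
and `a ≥ 0` with `Σ_i a_i/q_i < ∞`, the series `Σ_i (a_i − a_{i+1})/q_i` converges absolutely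
(`|a_i − a_{i+1}|/q_i ≤ a_i/q_i + a_{i+1}/q_{i+1}`) and its sum is `Σ_i a_i w_i` (summation by parts,
the boundary term `a_{m+1}/q_m ≤ a_{m+1}/q_{m+1} → 0`). [cite: Vihola2018, §4 Example 10];
[cite: RheeGlynn2015, Theorem 1] -/
theorem hasSum_sub_div_abelWeight {a : ℕ → ℝ} (hq0 : ∀ k, 0 < q k) (hqa : Antitone q)
    (ha0 : ∀ i, 0 ≤ a i) (hc : Summable fun i => a i / q i) :
    HasSum (fun i => (a i - a (i + 1)) / q i) (∑' i, a i * abelWeight q i) := by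
  set c : ℕ → ℝ := fun i => a i / q i with hc_def
  have haw : Summable (fun i => a i * abelWeight q i) := summable_mul_abelWeight hq0 hqa ha0 hc
  set T : ℝ := ∑' i, a i * abelWeight q i with hT_def
  have hf : Summable (fun i => (a i - a (i + 1)) / q i) := by
    refine Summable.of_norm_bounded (g := fun i => c i + c (i + 1))
      (hc.add ((summable_nat_add_iff 1).mpr hc)) (fun i => ?_)
    rw [Real.norm_eq_abs, abs_div, abs_of_pos (hq0 i)]
    have h1' : a (i + 1) / q i ≤ a (i + 1) / q (i + 1) :=
      div_le_div_of_nonneg_left (ha0 _) (hq0 _) (hqa (Nat.le_succ i))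
    calc |a i - a (i + 1)| / q i ≤ (a i + a (i + 1)) / q i := by
          gcongr
          · exact (hq0 i).le
          · exact (abs_sub _ _).trans_eq (by rw [abs_of_nonneg (ha0 i), abs_of_nonneg (ha0 _)])
      _ = c i + a (i + 1) / q i := by simp only [hc_def, add_div]
      _ ≤ c i + c (i + 1) := by simpa [hc_def] using h1'
  have h3 : Tendsto (fun m => ∑ i ∈ range (m + 1), (a i - a (i + 1)) / q i) atTop (𝓝 T) := by
    have hβ : Tendsto (fun m => ∑ i ∈ range (m + 1), a i * abelWeight q i) atTop (𝓝 T) :=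
      haw.hasSum.tendsto_sum_nat.comp (tendsto_add_atTop_nat 1)
    have hbd : Tendsto (fun m => a (m + 1) / q m) atTop (𝓝 0) := by
      refine squeeze_zero (fun m => div_nonneg (ha0 _) (hq0 m).le) (fun m => ?_)
        ((hc.tendsto_atTop_zero).comp (tendsto_add_atTop_nat 1))
      exact div_le_div_of_nonneg_left (ha0 _) (hq0 _) (hqa (Nat.le_succ m))
    have h := hβ.sub hbd
    rw [sub_zero] at h
    exact h.congr fun m => (sum_range_sub_div a q m).symm
  have h4 : Tendsto (fun m => ∑ i ∈ range (m + 1), (a i - a (i + 1)) / q i) atTop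
      (𝓝 (∑' i, (a i - a (i + 1)) / q i)) :=
    hf.hasSum.tendsto_sum_nat.comp (tendsto_add_atTop_nat 1)
  have hfT : ∑' i, (a i - a (i + 1)) / q i = T := tendsto_nhds_unique h4 h3
  rw [← hfT]
  exact hf.hasSum

/-- **RHEE–GLYNN 2015, THEOREM 1 / VIHOLA 2018, THEOREM 5 (coupled sum, infinitely many levels) —
THE SECOND MOMENT**: if the increments are square integrable, the level `R` is independent of the
products `Δ_iΔ_k`, `q_k = μ{k ≤ R} > 0`, and `S ∈ L²` satisfies the printed coupled-sum condition
`Σ_i E(Y_i − S)²/q_i < ∞` (printed: "`Σ_{i≥1} E(Y_{i−1} − Y)²/p̃_i < ∞`"), then `Z_Σ ∈ L²` and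
`E Z_Σ² = Σ_i (E(Y_i − S)² − E(Y_{i+1} − S)²)/q_i` (printed: "`E (Z_Σ⁽¹⁾)² = Σ_{i≥1} (E(Y_{i−1} − Y)²
− E(Y_i − Y)²)/p̃_i`"; Rhee–Glynn: "`E Y² = Σ_n (E|S − S_{n−1}|² − E|S − S_n|²)/P(N ≥ n)`"), the
series converging absolutely.  This is the infinite-level form left as TODO(general form) by
`integral_sumEstTrunc_sq_telescope`.
[cite: RheeGlynn2015, Theorem 1]; [cite: Vihola2018, §3 Theorem 5 with Condition 4 (i), §4
Example 10 and Appendix A]; [cite: JacobThiery2015, §1.2 Theorem 1.1 (quotation)] -/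
theorem hasSum_integral_sumEst_sq [IsFiniteMeasure μ] (hR : Measurable R)
    (hΔm : ∀ k, Measurable (Δ k)) (hΔ2 : ∀ k, MemLp (Δ k) 2 μ)
    (hind2 : ∀ i k, IndepFun R (fun ω => Δ i ω * Δ k ω) μ)
    (hq : ∀ k, μ.real {ω | k ≤ R ω} = q k) (hq0 : ∀ k, 0 < q k) {S : Ω → ℝ} (hS : MemLp S 2 μ)
    (hc : Summable fun i => (∫ ω, (partialSum Δ i ω - S ω) ^ 2 ∂μ) / q i) :
    HasSum (fun i => ((∫ ω, (partialSum Δ i ω - S ω) ^ 2 ∂μ) -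
        ∫ ω, (partialSum Δ (i + 1) ω - S ω) ^ 2 ∂μ) / q i) (∫ ω, sumEst Δ q R ω ^ 2 ∂μ) := by
  have hqa : Antitone q := antitone_of_measureReal_le hq
  have ha0 : ∀ i, 0 ≤ ∫ ω, (partialSum Δ i ω - S ω) ^ 2 ∂μ :=
    fun i => integral_nonneg fun ω => sq_nonneg _
  -- `E Z² = Σ_i E(Y_i − S)² w_i` by uniqueness of the limit of `E Z_m²`
  have h1 : Tendsto (fun m => ∫ ω, sumEstTrunc Δ q R m ω ^ 2 ∂μ) atTop
      (𝓝 (∫ ω, sumEst Δ q R ω ^ 2 ∂μ)) :=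
    tendsto_integral_sumEstTrunc_sq hR hΔm hΔ2 hind2 hq hq0 hS hc
  have h2 : Tendsto (fun m => ∫ ω, sumEstTrunc Δ q R m ω ^ 2 ∂μ) atTop
      (𝓝 (∑' i, (∫ ω, (partialSum Δ i ω - S ω) ^ 2 ∂μ) * abelWeight q i)) :=
    (tendsto_sum_mul_abelWeight hΔ2 hq0 hqa hS hc).congr
      fun m => (integral_sumEstTrunc_sq_abel hR hΔm hΔ2 hind2 hq hq0 m).symm
  rw [tendsto_nhds_unique h1 h2]
  exact hasSum_sub_div_abelWeight hq0 hqa ha0 hc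

/-- **VARIANCE OF THE COUPLED-SUM ESTIMATOR** (Vihola's Example 10 at `n = 1`):
`var(Z_Σ) = Σ_i (E(Y_i − S)² − E(Y_{i+1} − S)²)/q_i − (E S)²` (printed: "`var(Z⁽ⁿ⁾_{Σ,iid}) =
(1/n)(Σ_{i≥1} (E(Y_{i−1} − Y)² − E(Y_i − Y)²)/p̃_i − (E Y)²)`").
[cite: Vihola2018, §4 Example 10 (final display for the coupled sum)]; [cite: RheeGlynn2015,
Theorem 1] -/
theorem variance_sumEst [IsProbabilityMeasure μ] (hR : Measurable R)
    (hΔm : ∀ k, Measurable (Δ k)) (hΔ2 : ∀ k, MemLp (Δ k) 2 μ) (hind : ∀ k, IndepFun R (Δ k) μ)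
    (hind2 : ∀ i k, IndepFun R (fun ω => Δ i ω * Δ k ω) μ)
    (hq : ∀ k, μ.real {ω | k ≤ R ω} = q k) (hq0 : ∀ k, 0 < q k) {S : Ω → ℝ} (hS : MemLp S 2 μ)
    (hc : Summable fun i => (∫ ω, (partialSum Δ i ω - S ω) ^ 2 ∂μ) / q i) :
    variance (sumEst Δ q R) μ =
      (∑' i, ((∫ ω, (partialSum Δ i ω - S ω) ^ 2 ∂μ) -
        ∫ ω, (partialSum Δ (i + 1) ω - S ω) ^ 2 ∂μ) / q i) - (∫ ω, S ω ∂μ) ^ 2 := by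
  rw [variance_eq_sub (memLp_sumEst hR hΔm hΔ2 hind2 hq hq0 hS hc).1]
  simp only [Pi.pow_apply]
  rw [integral_sumEst_eq hR hΔm hΔ2 hind hind2 hq hq0 hS hc,
    (hasSum_integral_sumEst_sq hR hΔm hΔ2 hind2 hq hq0 hS hc).tsum_eq]

end InfiniteLevel

/-! ## The independent-sum case (Vihola 2018, Theorem 5 with Condition 4 (ii): uncorrelated
increments) -/

section IndependentSum

open Filter
open scoped Topology

variable [MeasurableSpace Ω] {μ : Measure Ω} {Δ : ℕ → Ω → ℝ} {q : ℕ → ℝ} {R : Ω → ℕ}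

/-- The MEANS of the approximations, `M_i = Σ_{k<i} E Δ_k` (`= E Y_i`; printed `E Y_{i}` with
`E Y_0 := 0`). [cite: Vihola2018, §3 Condition 4 (`E Δ_i = E Y_i − E Y_{i−1}`)] -/
def meanLevel (μ : Measure Ω) (Δ : ℕ → Ω → ℝ) (i : ℕ) : ℝ := ∑ k ∈ range i, ∫ ω, Δ k ω ∂μ

/-- `M_{i+1} = M_i + E Δ_i`. [cite: Vihola2018, §3 Condition 4] -/
theorem meanLevel_succ (μ : Measure Ω) (Δ : ℕ → Ω → ℝ) (i : ℕ) :
    meanLevel μ Δ (i + 1) = meanLevel μ Δ i + ∫ ω, Δ i ω ∂μ := by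
  simp [meanLevel, sum_range_succ]

/-- `M_n − M_{i+1} = Σ_{i<j<n} E Δ_j` for `i < n`. [cite: Vihola2018, §3 Condition 4] -/
theorem meanLevel_sub (μ : Measure Ω) (Δ : ℕ → Ω → ℝ) {i n : ℕ} (hin : i < n) :
    meanLevel μ Δ n - meanLevel μ Δ (i + 1) = ∑ j ∈ Ico (i + 1) n, ∫ ω, Δ j ω ∂μ := by
  unfold meanLevel
  rw [sum_Ico_eq_sub _ (Nat.succ_le_of_lt hin)]

/-- `E Y_i = M_i`. [cite: Vihola2018, §3 (first display, `E Y_n = Σ_{i≤n} E(Y_i − Y_{i−1})`)] -/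
theorem integral_partialSum_eq_meanLevel (hΔi : ∀ k, Integrable (Δ k) μ) (i : ℕ) :
    ∫ ω, partialSum Δ i ω ∂μ = meanLevel μ Δ i := by
  unfold partialSum meanLevel
  exact integral_finsetSum _ fun k _ => hΔi k

/-- Two-index second moment for UNCORRELATED increments (Vihola's `v_{ℓ,m}` in the independent-sum
case, at `n = 1`): for `m ≤ n`,
`E(Z_n − Z_m)² = Σ_{m≤i<n} (var Δ_i + (M_n − M_i)² − (M_n − M_{i+1})²)/q_i`
("`v_{ℓ,m} = Σ_{i=ℓ+1}^m (var(Δ_i) + (E Y_{i−1} − E Y_m)² − (E Y_i − E Y_m)²)/p̃_i − (E Y_m − E Y_ℓ)²`",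
where `v + (E Y_m − E Y_ℓ)²` is the second moment). [cite: Vihola2018, §4 Example 10 (display
"It is straightforward to check that then `v_{ℓ,m} = …`")] -/
theorem integral_sub_sumEstTrunc_sq_uncorr (hR : Measurable R) (hΔm : ∀ k, Measurable (Δ k))
    (hΔ2 : ∀ k, MemLp (Δ k) 2 μ) (hind2 : ∀ i k, IndepFun R (fun ω => Δ i ω * Δ k ω) μ)
    (hunc : ∀ i j, i ≠ j → ∫ ω, Δ i ω * Δ j ω ∂μ = (∫ ω, Δ i ω ∂μ) * ∫ ω, Δ j ω ∂μ)
    (hq : ∀ k, μ.real {ω | k ≤ R ω} = q k) (hq0 : ∀ k, 0 < q k) {m n : ℕ} (hmn : m ≤ n) :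
    ∫ ω, (sumEstTrunc Δ q R n ω - sumEstTrunc Δ q R m ω) ^ 2 ∂μ =
      ∑ i ∈ Ico m n, ((∫ ω, Δ i ω ^ 2 ∂μ) - (∫ ω, Δ i ω ∂μ) ^ 2) / q i +
        ∑ i ∈ Ico m n, ((meanLevel μ Δ n - meanLevel μ Δ i) ^ 2 -
          (meanLevel μ Δ n - meanLevel μ Δ (i + 1)) ^ 2) / q i := by
  rw [integral_sub_sumEstTrunc_sq hR hΔm hΔ2 hind2 hq hq0 hmn, mul_sum, ← sum_add_distrib,
    ← sum_add_distrib]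
  refine sum_congr rfl (fun i hi => ?_)
  rw [mem_Ico] at hi
  have hcross : ∑ j ∈ Ico (i + 1) n, (∫ ω, Δ i ω * Δ j ω ∂μ) / q i =
      (∫ ω, Δ i ω ∂μ) * (meanLevel μ Δ n - meanLevel μ Δ (i + 1)) / q i := by
    rw [meanLevel_sub μ Δ hi.2, mul_sum, sum_div]
    refine sum_congr rfl (fun j hj => ?_)
    rw [mem_Ico] at hj
    rw [hunc i j (by omega)]
  rw [hcross]
  have e := meanLevel_succ μ Δ i
  rw [show meanLevel μ Δ i = meanLevel μ Δ (i + 1) - ∫ ω, Δ i ω ∂μ by rw [e]; ring]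
  ring

/-- `(E Δ)² ≤ E Δ²` on a probability space, i.e. `var Δ_i = E Δ_i² − (E Δ_i)² ≥ 0`.
[cite: Vihola2018, §3 Condition 4 (ii) (`var(Δ_i)`)] -/
theorem sq_integral_le_integral_sq [IsProbabilityMeasure μ] {X : Ω → ℝ} (hX : MemLp X 2 μ) :
    (∫ ω, X ω ∂μ) ^ 2 ≤ ∫ ω, X ω ^ 2 ∂μ := by
  have hv := variance_nonneg X μ
  rw [variance_eq_sub hX] at hv
  simp only [Pi.pow_apply] at hv
  linarith

/-- **VIHOLA'S CAUCHY BOUND, INDEPENDENT-SUM CASE**: for uncorrelated increments and any real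
`L` (the printed `E Y`), `E(Z_n − Z_m)² ≤ 4 Σ_{m≤i≤n} (var Δ_i + (L − M_i)²)/q_i` for `m ≤ n`
(the variance part is a non-negative series, the mean part is the coupled-sum estimate applied to
the deterministic sequence `M_i`). [cite: Vihola2018, §4 Example 10 ("which satisfies
`lim_ℓ sup_m v_{ℓ,m} = 0` by assumption")] -/
theorem integral_sub_sumEstTrunc_sq_le_uncorr [IsProbabilityMeasure μ] (hR : Measurable R)
    (hΔm : ∀ k, Measurable (Δ k)) (hΔ2 : ∀ k, MemLp (Δ k) 2 μ)
    (hind2 : ∀ i k, IndepFun R (fun ω => Δ i ω * Δ k ω) μ)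
    (hunc : ∀ i j, i ≠ j → ∫ ω, Δ i ω * Δ j ω ∂μ = (∫ ω, Δ i ω ∂μ) * ∫ ω, Δ j ω ∂μ)
    (hq : ∀ k, μ.real {ω | k ≤ R ω} = q k) (hq0 : ∀ k, 0 < q k) (L : ℝ) {m n : ℕ} (hmn : m ≤ n) :
    ∫ ω, (sumEstTrunc Δ q R n ω - sumEstTrunc Δ q R m ω) ^ 2 ∂μ ≤
      4 * ∑ i ∈ Ico m (n + 1), (((∫ ω, Δ i ω ^ 2 ∂μ) - (∫ ω, Δ i ω ∂μ) ^ 2) +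
        (L - meanLevel μ Δ i) ^ 2) / q i := by
  set v : ℕ → ℝ := fun i => (∫ ω, Δ i ω ^ 2 ∂μ) - (∫ ω, Δ i ω ∂μ) ^ 2 with hv_def
  set a : ℕ → ℝ := fun i => (L - meanLevel μ Δ i) ^ 2 with ha_def
  set b : ℕ → ℝ := fun i => (meanLevel μ Δ n - meanLevel μ Δ i) ^ 2 with hb_def
  have hqa : Antitone q := antitone_of_measureReal_le hq
  have hv0 : ∀ i, 0 ≤ v i := fun i => sub_nonneg.mpr (sq_integral_le_integral_sq (hΔ2 i))
  have ha0 : ∀ i, 0 ≤ a i := fun i => sq_nonneg _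
  have hbn : b n = 0 := by simp [hb_def]
  have hb : ∀ i, b i ≤ 2 * a i + 2 * a n := by
    intro i
    simp only [hb_def, ha_def]
    nlinarith [sq_nonneg ((L - meanLevel μ Δ i) + (L - meanLevel μ Δ n))]
  rw [integral_sub_sumEstTrunc_sq_uncorr hR hΔm hΔ2 hind2 hunc hq hq0 hmn]
  have h1 : ∑ i ∈ Ico m n, (b i - b (i + 1)) / q i ≤ 4 * ∑ i ∈ Ico m (n + 1), a i / q i :=
    sum_Ico_sub_div_le hq0 hqa ha0 hmn hbn hb
  have h2 : ∑ i ∈ Ico m n, v i / q i ≤ ∑ i ∈ Ico m (n + 1), v i / q i :=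
    sum_le_sum_of_subset_of_nonneg (Ico_subset_Ico_right (Nat.le_succ n))
      (fun i _ _ => div_nonneg (hv0 i) (hq0 i).le)
  have h3 : 0 ≤ ∑ i ∈ Ico m (n + 1), v i / q i :=
    sum_nonneg fun i _ => div_nonneg (hv0 i) (hq0 i).le
  have e : ∑ i ∈ Ico m (n + 1), (v i + a i) / q i =
      ∑ i ∈ Ico m (n + 1), v i / q i + ∑ i ∈ Ico m (n + 1), a i / q i := by
    rw [← sum_add_distrib]
    exact sum_congr rfl fun i _ => add_div _ _ _
  show ∑ i ∈ Ico m n, v i / q i + ∑ i ∈ Ico m n, (b i - b (i + 1)) / q i ≤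
    4 * ∑ i ∈ Ico m (n + 1), (v i + a i) / q i
  rw [e]
  linarith

/-- **VIHOLA 2018, THEOREM 5, INDEPENDENT-SUM CASE — square integrability, `L²` convergence and
unbiasedness**: if the increments are square integrable and UNCORRELATED, `R` is independent of
the products `Δ_iΔ_k` (and of each `Δ_k`), `q_k = μ{k ≤ R} > 0`, and for some real `L` (the printed
`E Y`) the printed Condition 4 (ii) holds, `Σ_i (var Δ_i + (L − M_i)²)/q_i < ∞` (printed
"`Σ_{i≥1} (var(Δ_i) + (E Y − E Y_{i−1})²)/p̃_i < ∞`"), then for every `m`, `Z_Σ − Z_m ∈ L²` with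
`E(Z_Σ − Z_m)² ≤ 4 Σ_{i≥m} (var Δ_i + (L − M_i)²)/q_i`; in particular `Z_Σ ∈ L²`.
[cite: Vihola2018, §3 Theorem 5 with Condition 4 (ii); §4 Example 10; Appendix A] -/
theorem memLp_sub_sumEstTrunc_uncorr [IsProbabilityMeasure μ] (hR : Measurable R)
    (hΔm : ∀ k, Measurable (Δ k)) (hΔ2 : ∀ k, MemLp (Δ k) 2 μ)
    (hind2 : ∀ i k, IndepFun R (fun ω => Δ i ω * Δ k ω) μ)
    (hunc : ∀ i j, i ≠ j → ∫ ω, Δ i ω * Δ j ω ∂μ = (∫ ω, Δ i ω ∂μ) * ∫ ω, Δ j ω ∂μ)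
    (hq : ∀ k, μ.real {ω | k ≤ R ω} = q k) (hq0 : ∀ k, 0 < q k) {L : ℝ}
    (hc : Summable fun i => (((∫ ω, Δ i ω ^ 2 ∂μ) - (∫ ω, Δ i ω ∂μ) ^ 2) +
      (L - meanLevel μ Δ i) ^ 2) / q i) (m : ℕ) :
    MemLp (fun ω => sumEst Δ q R ω - sumEstTrunc Δ q R m ω) 2 μ ∧
      ∫ ω, (sumEst Δ q R ω - sumEstTrunc Δ q R m ω) ^ 2 ∂μ ≤
        4 * ∑' i, (((∫ ω, Δ (i + m) ω ^ 2 ∂μ) - (∫ ω, Δ (i + m) ω ∂μ) ^ 2) +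
          (L - meanLevel μ Δ (i + m)) ^ 2) / q (i + m) := by
  set c : ℕ → ℝ := fun i => (((∫ ω, Δ i ω ^ 2 ∂μ) - (∫ ω, Δ i ω ∂μ) ^ 2) +
      (L - meanLevel μ Δ i) ^ 2) / q i with hc_def
  have hc0 : ∀ i, 0 ≤ c i := fun i => div_nonneg
    (add_nonneg (sub_nonneg.mpr (sq_integral_le_integral_sq (hΔ2 i))) (sq_nonneg _)) (hq0 i).le
  have hcs : Summable (fun i => c (i + m)) := (summable_nat_add_iff m).mpr hc
  have hτ0 : 0 ≤ ∑' i, c (i + m) := tsum_nonneg fun i => hc0 _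
  refine memLp_sub_sumEstTrunc_of_bound hR hΔm hΔ2 (by positivity) (fun n hmn => ?_)
  refine (integral_sub_sumEstTrunc_sq_le_uncorr hR hΔm hΔ2 hind2 hunc hq hq0 L hmn).trans ?_
  refine mul_le_mul_of_nonneg_left ?_ (by norm_num)
  show ∑ i ∈ Ico m (n + 1), c i ≤ ∑' i, c (i + m)
  rw [sum_Ico_eq_sum_range]
  have e : ∀ k, c (m + k) = c (k + m) := fun k => by rw [add_comm]
  simp only [e]
  exact hcs.sum_le_tsum (range (n + 1 - m)) (fun k _ => hc0 _)

/-- `E(Z_Σ − Z_m)² → 0` in the independent-sum case. [cite: Vihola2018, Appendix A (proof of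
Theorem 7)] -/
theorem tendsto_integral_sub_sumEstTrunc_sq_uncorr [IsProbabilityMeasure μ] (hR : Measurable R)
    (hΔm : ∀ k, Measurable (Δ k)) (hΔ2 : ∀ k, MemLp (Δ k) 2 μ)
    (hind2 : ∀ i k, IndepFun R (fun ω => Δ i ω * Δ k ω) μ)
    (hunc : ∀ i j, i ≠ j → ∫ ω, Δ i ω * Δ j ω ∂μ = (∫ ω, Δ i ω ∂μ) * ∫ ω, Δ j ω ∂μ)
    (hq : ∀ k, μ.real {ω | k ≤ R ω} = q k) (hq0 : ∀ k, 0 < q k) {L : ℝ}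
    (hc : Summable fun i => (((∫ ω, Δ i ω ^ 2 ∂μ) - (∫ ω, Δ i ω ∂μ) ^ 2) +
      (L - meanLevel μ Δ i) ^ 2) / q i) :
    Tendsto (fun m => ∫ ω, (sumEst Δ q R ω - sumEstTrunc Δ q R m ω) ^ 2 ∂μ) atTop (𝓝 0) := by
  have hτ : Tendsto (fun m => 4 * ∑' i, (((∫ ω, Δ (i + m) ω ^ 2 ∂μ) - (∫ ω, Δ (i + m) ω ∂μ) ^ 2)
      + (L - meanLevel μ Δ (i + m)) ^ 2) / q (i + m)) atTop (𝓝 0) := by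
    have h := (tendsto_sum_nat_add fun i => (((∫ ω, Δ i ω ^ 2 ∂μ) - (∫ ω, Δ i ω ∂μ) ^ 2) +
      (L - meanLevel μ Δ i) ^ 2) / q i).const_mul (4 : ℝ)
    simpa using h
  exact squeeze_zero (fun m => integral_nonneg fun ω => sq_nonneg _)
    (fun m => (memLp_sub_sumEstTrunc_uncorr hR hΔm hΔ2 hind2 hunc hq hq0 hc m).2) hτ

/-- **VIHOLA 2018, THEOREM 5, INDEPENDENT-SUM CASE — UNBIASEDNESS**: under Condition 4 (ii) (with
`R` also independent of each `Δ_k`), `E Y_m = M_m → L` and `E Z_Σ = L` ("satisfies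
`E Z_Σ⁽¹⁾ = E Y`"). [cite: Vihola2018, §3 Theorem 5 (first claim) with Condition 4 (ii)] -/
theorem integral_sumEst_eq_uncorr [IsProbabilityMeasure μ] (hR : Measurable R)
    (hΔm : ∀ k, Measurable (Δ k)) (hΔ2 : ∀ k, MemLp (Δ k) 2 μ) (hind : ∀ k, IndepFun R (Δ k) μ)
    (hind2 : ∀ i k, IndepFun R (fun ω => Δ i ω * Δ k ω) μ)
    (hunc : ∀ i j, i ≠ j → ∫ ω, Δ i ω * Δ j ω ∂μ = (∫ ω, Δ i ω ∂μ) * ∫ ω, Δ j ω ∂μ)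
    (hq : ∀ k, μ.real {ω | k ≤ R ω} = q k) (hq0 : ∀ k, 0 < q k) {L : ℝ}
    (hc : Summable fun i => (((∫ ω, Δ i ω ^ 2 ∂μ) - (∫ ω, Δ i ω ∂μ) ^ 2) +
      (L - meanLevel μ Δ i) ^ 2) / q i) :
    ∫ ω, sumEst Δ q R ω ∂μ = L := by
  have hq1 : ∀ k, q k ≤ 1 := fun k => by rw [← hq k]; exact measureReal_le_one
  have hv0 : ∀ i, 0 ≤ (∫ ω, Δ i ω ^ 2 ∂μ) - (∫ ω, Δ i ω ∂μ) ^ 2 :=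
    fun i => sub_nonneg.mpr (sq_integral_le_integral_sq (hΔ2 i))
  -- `(L − M_m)² ≤ c_m → 0`, hence `M_m → L`
  have ha : Tendsto (fun m => (L - meanLevel μ Δ m) ^ 2) atTop (𝓝 0) := by
    refine squeeze_zero (fun m => sq_nonneg _) (fun m => ?_) hc.tendsto_atTop_zero
    have hcm : 0 ≤ ((∫ ω, Δ m ω ^ 2 ∂μ) - (∫ ω, Δ m ω ∂μ) ^ 2) + (L - meanLevel μ Δ m) ^ 2 :=
      add_nonneg (hv0 m) (sq_nonneg _)
    calc (L - meanLevel μ Δ m) ^ 2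
        ≤ ((∫ ω, Δ m ω ^ 2 ∂μ) - (∫ ω, Δ m ω ∂μ) ^ 2) + (L - meanLevel μ Δ m) ^ 2 :=
          le_add_of_nonneg_left (hv0 m)
      _ = (((∫ ω, Δ m ω ^ 2 ∂μ) - (∫ ω, Δ m ω ∂μ) ^ 2) + (L - meanLevel μ Δ m) ^ 2) / q m * q m := by
          field_simp [(hq0 m).ne']
      _ ≤ (((∫ ω, Δ m ω ^ 2 ∂μ) - (∫ ω, Δ m ω ∂μ) ^ 2) + (L - meanLevel μ Δ m) ^ 2) / q m * 1 :=
          mul_le_mul_of_nonneg_left (hq1 m) (div_nonneg hcm (hq0 m).le)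
      _ = _ := mul_one _
  have hM : Tendsto (fun m => meanLevel μ Δ m) atTop (𝓝 L) := by
    have h1 : Tendsto (fun m => |L - meanLevel μ Δ m|) atTop (𝓝 0) := by
      have := ha.sqrt
      simpa [Real.sqrt_sq_eq_abs] using this
    have h2 : Tendsto (fun m => L - meanLevel μ Δ m) atTop (𝓝 0) :=
      (tendsto_zero_iff_norm_tendsto_zero).mpr (by simpa [Real.norm_eq_abs] using h1)
    have h3 := (tendsto_const_nhds (x := L)).sub h2
    simpa using h3
  exact integral_eq_of_tendsto (Zm := fun m => sumEstTrunc Δ q R m)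
    (by simpa [sumEstTrunc] using (memLp_sub_sumEstTrunc_uncorr hR hΔm hΔ2 hind2 hunc hq hq0 hc 0).1)
    (memLp_sumEstTrunc hR hΔ2)
    (tendsto_integral_sub_sumEstTrunc_sq_uncorr hR hΔm hΔ2 hind2 hunc hq hq0 hc)
    (fun m => (integral_sumEstTrunc hR hΔm (fun k => (hΔ2 k).integrable one_le_two) hind hq hq0
      m).trans (integral_partialSum_eq_meanLevel (fun k => (hΔ2 k).integrable one_le_two) m))
    hM

/-- **VIHOLA 2018, THEOREM 5, INDEPENDENT-SUM CASE — THE SECOND MOMENT** (Rhee–Glynn's Theorem 2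
for the independent sum): under the hypotheses of `memLp_sub_sumEstTrunc_uncorr`,
`E Z_Σ² = Σ_i (var Δ_i + (L − M_i)² − (L − M_{i+1})²)/q_i` (printed: "`E(Z_Σ⁽¹⁾)² = Σ_{i≥1}
(var(Δ_i) + (E Y − E Y_{i−1})² − (E Y − E Y_i)²)/p̃_i`"), the series converging absolutely.
[cite: Vihola2018, §3 Theorem 5 (second display) with Condition 4 (ii); §4 Example 10];
[cite: RheeGlynn2015, Theorem 2]; [cite: ZhengPanWang2023, §2 Theorem 2.2 (restatement)] -/
theorem hasSum_integral_sumEst_sq_uncorr [IsProbabilityMeasure μ] (hR : Measurable R)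
    (hΔm : ∀ k, Measurable (Δ k)) (hΔ2 : ∀ k, MemLp (Δ k) 2 μ)
    (hind2 : ∀ i k, IndepFun R (fun ω => Δ i ω * Δ k ω) μ)
    (hunc : ∀ i j, i ≠ j → ∫ ω, Δ i ω * Δ j ω ∂μ = (∫ ω, Δ i ω ∂μ) * ∫ ω, Δ j ω ∂μ)
    (hq : ∀ k, μ.real {ω | k ≤ R ω} = q k) (hq0 : ∀ k, 0 < q k) {L : ℝ}
    (hc : Summable fun i => (((∫ ω, Δ i ω ^ 2 ∂μ) - (∫ ω, Δ i ω ∂μ) ^ 2) +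
      (L - meanLevel μ Δ i) ^ 2) / q i) :
    HasSum (fun i => (((∫ ω, Δ i ω ^ 2 ∂μ) - (∫ ω, Δ i ω ∂μ) ^ 2) +
        ((L - meanLevel μ Δ i) ^ 2 - (L - meanLevel μ Δ (i + 1)) ^ 2)) / q i)
      (∫ ω, sumEst Δ q R ω ^ 2 ∂μ) := by
  set v : ℕ → ℝ := fun i => (∫ ω, Δ i ω ^ 2 ∂μ) - (∫ ω, Δ i ω ∂μ) ^ 2 with hv_def
  set a : ℕ → ℝ := fun i => (L - meanLevel μ Δ i) ^ 2 with ha_def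
  have hqa : Antitone q := antitone_of_measureReal_le hq
  have hv0 : ∀ i, 0 ≤ v i := fun i => sub_nonneg.mpr (sq_integral_le_integral_sq (hΔ2 i))
  have ha0 : ∀ i, 0 ≤ a i := fun i => sq_nonneg _
  have hcv : Summable fun i => v i / q i :=
    Summable.of_nonneg_of_le (fun i => div_nonneg (hv0 i) (hq0 i).le)
      (fun i => div_le_div_of_nonneg_right (le_add_of_nonneg_right (ha0 i)) (hq0 i).le) hc
  have hca : Summable fun i => a i / q i :=
    Summable.of_nonneg_of_le (fun i => div_nonneg (ha0 i) (hq0 i).le)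
      (fun i => div_le_div_of_nonneg_right (le_add_of_nonneg_left (hv0 i)) (hq0 i).le) hc
  -- the finite-level second moment in Abel form: `E Z_m² = Σ_{i<m} v_i/q_i + Σ_{i<m} b^m_i w_i`
  have hfin : ∀ m, ∫ ω, sumEstTrunc Δ q R m ω ^ 2 ∂μ =
      ∑ i ∈ range m, v i / q i +
        ∑ i ∈ range m, (meanLevel μ Δ m - meanLevel μ Δ i) ^ 2 * abelWeight q i := by
    intro m
    have h := integral_sub_sumEstTrunc_sq_uncorr hR hΔm hΔ2 hind2 hunc hq hq0 (Nat.zero_le m)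
    have hZ0 : ∀ ω, sumEstTrunc Δ q R 0 ω = 0 := fun ω => by simp [sumEstTrunc]
    simp only [hZ0, sub_zero, Nat.Ico_zero_eq_range] at h
    rw [h]
    congr 1
    cases m with
    | zero => simp
    | succ k =>
      have h2 := sum_range_sub_div (fun i => (meanLevel μ Δ (k + 1) - meanLevel μ Δ i) ^ 2) q k
      beta_reduce at h2
      rw [h2]
      simp
  -- limits of the two parts
  have h1 : Tendsto (fun m => ∫ ω, sumEstTrunc Δ q R m ω ^ 2 ∂μ) atTop
      (𝓝 (∫ ω, sumEst Δ q R ω ^ 2 ∂μ)) :=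
    tendsto_integral_sq_of_tendsto
      (by simpa [sumEstTrunc] using
        (memLp_sub_sumEstTrunc_uncorr hR hΔm hΔ2 hind2 hunc hq hq0 hc 0).1)
      (memLp_sumEstTrunc hR hΔ2)
      (tendsto_integral_sub_sumEstTrunc_sq_uncorr hR hΔm hΔ2 hind2 hunc hq hq0 hc)
  have hV : Tendsto (fun m => ∑ i ∈ range m, v i / q i) atTop (𝓝 (∑' i, v i / q i)) :=
    hcv.hasSum.tendsto_sum_nat
  have hT : Tendsto (fun m => ∑ i ∈ range m,
      (meanLevel μ Δ m - meanLevel μ Δ i) ^ 2 * abelWeight q i) atTop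
      (𝓝 (∑' i, a i * abelWeight q i)) := by
    refine tendsto_sum_mul_abelWeight_of_abs_sub_le
      (b := fun m i => (meanLevel μ Δ m - meanLevel μ Δ i) ^ 2) hq0 hqa ha0 hca (fun m i => ?_)
    -- `|(M_m − M_i)² − (L − M_i)²| ≤ √(a_m) √(6 a_i + 4 a_m)`
    have e : (meanLevel μ Δ m - meanLevel μ Δ i) ^ 2 - a i =
        (L - meanLevel μ Δ m) * ((meanLevel μ Δ i - meanLevel μ Δ m) + (meanLevel μ Δ i - L)) := by
      simp only [ha_def]
      ring
    have hu : ((meanLevel μ Δ i - meanLevel μ Δ m) + (meanLevel μ Δ i - L)) ^ 2 ≤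
        6 * a i + 4 * a m := by
      simp only [ha_def]
      nlinarith [sq_nonneg ((L - meanLevel μ Δ i) + (L - meanLevel μ Δ m)),
        sq_nonneg (L - meanLevel μ Δ m), sq_nonneg (L - meanLevel μ Δ i)]
    show |(meanLevel μ Δ m - meanLevel μ Δ i) ^ 2 - a i| ≤ _
    rw [e, abs_mul]
    have e1 : |L - meanLevel μ Δ m| = Real.sqrt (a m) := by
      rw [ha_def]
      exact (Real.sqrt_sq_eq_abs _).symm
    rw [e1]
    refine mul_le_mul_of_nonneg_left ?_ (Real.sqrt_nonneg _)
    exact Real.abs_le_sqrt hu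
  have h2 : Tendsto (fun m => ∫ ω, sumEstTrunc Δ q R m ω ^ 2 ∂μ) atTop
      (𝓝 (∑' i, v i / q i + ∑' i, a i * abelWeight q i)) :=
    (hV.add hT).congr fun m => (hfin m).symm
  rw [tendsto_nhds_unique h1 h2]
  have hsum := hcv.hasSum.add (hasSum_sub_div_abelWeight hq0 hqa ha0 hca)
  refine hsum.congr_fun fun i => ?_
  simp only [hv_def, ha_def, add_div]

end IndependentSum

/-! ## Expected cost -/

section Cost

variable [MeasurableSpace Ω] {μ : Measure Ω} {R : Ω → ℕ}

/-- **EXPECTED WORK OF THE SUM ESTIMATOR** — [RheeGlynn2012, §2 eq. (3)]: with `t_k` the incremental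
effort of level `k`, "The expected computational work required for each `Z` is … `E Σ_{i=0}^N t_i`
… and hence can be expressed as `Σ_{i=0}^∞ t_i P(N ≥ i)`".  Here in `ℝ≥0∞`, no summability needed.
[cite: RheeGlynn2012, §2 eq. (3)] -/
theorem lintegral_cost_sumEst (hR : Measurable R) (t : ℕ → ℝ≥0∞) :
    ∫⁻ ω, ∑ k ∈ range (R ω + 1), t k ∂μ = ∑' k, t k * μ {ω | k ≤ R ω} := by
  have hpt : ∀ ω, ∑ k ∈ range (R ω + 1), t k = ∑' k, {ω | k ≤ R ω}.indicator (fun _ => t k) ω := by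
    intro ω
    rw [tsum_eq_sum (s := range (R ω + 1)) (fun k hk => ?_)]
    · refine sum_congr rfl (fun k hk => ?_)
      rw [mem_range] at hk
      simp [Nat.lt_succ_iff.mp hk]
    · rw [mem_range, not_lt] at hk
      simp only [Set.indicator_apply, Set.mem_setOf_eq, ite_eq_right_iff]
      intro h
      exfalso
      omega
  have hs : ∀ k, MeasurableSet {ω | k ≤ R ω} := fun k => hR measurableSet_Ici
  simp_rw [hpt]
  rw [lintegral_tsum (f := fun k ω => ({ω | k ≤ R ω} : Set Ω).indicator (fun _ => t k) ω)
    (fun k => (measurable_const.indicator (hs k)).aemeasurable)]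
  refine tsum_congr (fun k => ?_)
  rw [lintegral_indicator_const (hs k)]

/-- Expected work of the single-term estimator: `E t_R = Σ_k t_k μ{R = k}` (if level `k` must be
built from scratch; with coupled levels replace `t_k` by the cumulative cost).
[cite: RheeGlynn2012, §2 eq. (3) (the same accounting for one term)] -/
theorem lintegral_cost_singleTerm (hR : Measurable R) (t : ℕ → ℝ≥0∞) :
    ∫⁻ ω, t (R ω) ∂μ = ∑' k, t k * μ {ω | R ω = k} := by
  have hpt : ∀ ω, t (R ω) = ∑' k, {ω | R ω = k}.indicator (fun _ => t k) ω := by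
    intro ω
    rw [tsum_eq_single (R ω) (fun k hk => ?_)]
    · simp
    · simp only [Set.indicator_apply, Set.mem_setOf_eq, ite_eq_right_iff]
      exact fun h => absurd h.symm hk
  have hs : ∀ k, MeasurableSet {ω | R ω = k} := fun k => hR (measurableSet_singleton k)
  simp_rw [hpt]
  rw [lintegral_tsum (f := fun k ω => ({ω | R ω = k} : Set Ω).indicator (fun _ => t k) ω)
    (fun k => (measurable_const.indicator (hs k)).aemeasurable)]
  refine tsum_congr (fun k => ?_)
  rw [lintegral_indicator_const (hs k)]

/-- **EXPECTED NUMBER OF LEVELS** — McLeish's cost constraint "`Σ_n Q_n = μ`", i.e.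
`E N = Σ_{n≥1} P(N ≥ n)`: here `E R = Σ_k μ{k+1 ≤ R}` in `ℝ≥0∞`. [cite: McLeish2011, §2 ("subject to
`Σ_n Q_n = μ`")] -/
theorem lintegral_level_eq_tsum (hR : Measurable R) :
    ∫⁻ ω, (R ω : ℝ≥0∞) ∂μ = ∑' k, μ {ω | k + 1 ≤ R ω} := by
  have hpt : ∀ ω, (R ω : ℝ≥0∞) = ∑' k, {ω | k + 1 ≤ R ω}.indicator (fun _ => (1 : ℝ≥0∞)) ω := by
    intro ω
    rw [tsum_eq_sum (s := range (R ω)) (fun k hk => ?_)]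
    · have h1 : ∀ k ∈ range (R ω),
          ({ω | k + 1 ≤ R ω} : Set Ω).indicator (fun _ => (1 : ℝ≥0∞)) ω = 1 := by
        intro k hk
        rw [mem_range] at hk
        simp [hk]
      rw [sum_congr rfl h1]
      simp
    · rw [mem_range, not_lt] at hk
      simp only [Set.indicator_apply, Set.mem_setOf_eq, ite_eq_right_iff]
      intro h
      exfalso
      omega
  have hs : ∀ k, MeasurableSet {ω | k + 1 ≤ R ω} := fun k => hR measurableSet_Ici
  simp_rw [hpt]
  rw [lintegral_tsum (f := fun k ω => ({ω | k + 1 ≤ R ω} : Set Ω).indicator (fun _ => (1 : ℝ≥0∞)) ω)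
    (fun k => (measurable_const.indicator (hs k)).aemeasurable)]
  refine tsum_congr (fun k => ?_)
  rw [lintegral_indicator_const (hs k), one_mul]

end Cost

end RandomizedTruncation

end Literature.Probability.Moments

end
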